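import Summits.QuantumFields.YangMills.Theorems.BalabanUVNodesK0V19Defs
import Summits.QuantumFields.YangMills.Theorems.BalabanUVNodesK0Stub3RunwiseSuppliers
import Summits.QuantumFields.YangMills.Theorems.BalabanUVNodesK0Stub3FinVolPeriodicity
import Summits.QuantumFields.YangMills.Theorems.BalabanUVNodesK0Stub3FinVolFace
import Summits.QuantumFields.YangMills.Theorems.BalabanUVNodesK0Stub3SocketWindowEdition
import Literature.MathematicalPhysics.QuantumFieldTheory.Balaban1983to89.B12Sec2to5

/-!
# IDEA-6 (lens «barrier») on K0⁷ stmt-QuantumFields-20541 — crux idea `hesscov-heredity-k0`, EDITION 4 sketch = EDITION 3 (round 3: answers CRIT-2's ROUND 2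
# `Cruxes/Record13SepCoPHInhabited/CRIT-2-ROUND2-hesscov-heredity-k0.md`, cuts C3 ∕ C4 ∕ C5) + §6 ERRATUM E-g11 (the finite-volume CURRENCY re-typed, by name)

Cell `ym-nodeO-ideate`, seat `ym-nodeO-idea-6` g8 (§1–§5) ∕ g11 (§6) (planner; count-neutral; tree imports only).  Namespace `YMNodeOIdeate.Idea6.HessCovK0v3` (kept, so that
by-name citations of editions 3 stay valid).  Edition 4 supersedes edition 3 of this file (commit eab87959e568) IN PLACE; edition 3 superseded edition 2 (commit a203dcc08200).  EDITION 4.1 (same session g11,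
minutes after edition 4 = commit 13282c8bc333): adds §6.4 ONLY (the K-UNIFORM fundamental-domain twin BY NAME through k0-s3-w2's FILE 2 p613354 `K0Stub3FinVolFace`, landed 07:43Z) and one import; §1–§6.3 byte-identical.  [15] = [Balaban1985Variational] = CMP 102, 277–309; [I] = [Balaban1987RG1] = CMP 109;
[Dim] = Dimock, arXiv:1108.1335 (the scalar caricature of [I]).

EDITION 4.2 (seat g14, 2026-08-28 ≈09:15Z; INSERT-ONLY — §1–§6.4 byte-identical to edition 4.1 499296dcdac0494e, one import added): adds §6.5 ONLY = ERRATUM-LITE E-g14, THE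
WINDOW-EDITION RE-KEY OF THE CARD's ASSEMBLY TARGET, BY NAME through k0-s3-w1 g0-0's p618788 `Theorems/BalabanUVNodesK0Stub3SocketWindowEdition.lean` (commit f4f1ca6ec4ec).  THE POINT
(located, typing only — no lever, no price, no self-placement change): §6.3's `XPrimeAt F` keys its K4 conjunct `PolLimitsExistOfRecord₁₃ F 2 θ₁₅ᶜᶜᴹ(j)` on the collared witness's DESIGN
window `Window ½` — (1.21) for ALL histories with couplings up to `½`, K0a's display default — whereas print gives (1.7) ∕ (1.21) for «γ sufficiently small» only ([I] Thm 1 p.255, §1 p.264,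
(1.7) p.261; [II] (1.4) p.357): an OVER-DEMAND sitting in the line's FIRST stub (K4, CRIT-2's `stub_polLimitOnBox`).  `XPrimeAt` stays a CORRECT sufficient condition (§6.3 ★★ is a theorem);
§6.5 types the honest deliverable `XDoublePrimeAt F` — the SAME two letters AT THE WINDOW WITNESS `θ₁₅ᶜᶜᴹᵂ(j; γ₀)` of A2ʷ (`Node00.theta13OfThm1CCMW`, design window `γ₀`): K4 on
`Window γ₀`, decay on `]0, γ₀]` — proves the θ-GENERIC own-window road (§6.2 at `γ₀ := θ.γ` + p608074 §3 `absBetaBox_of_kernelDecayWindowUniform`), reaches 3ᴬ′ and K0⁷ BY NAME through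
p618788's road schema (`abs3A'_of_genericRoadAtWindowWitness` ∕ `record13SepCoPHInhabited_of_stub1_genericRoadAtWindowWitness_byName` with `P := OwnWindowDecayPackageAt F`), and
CERTIFIES `XPrimeAt F → XDoublePrimeAt F` (the re-key WEAKENS the deliverable; A2ʷ's `rfl`-level field agreement of the two witnesses).  [II] = [Balaban1989LargeFieldII] = CMP 122, 355–392.

WHAT CHANGED SINCE EDITION 3 (g11, §6 only; §1–§5 byte-identical).  ERRATUM E-g11 — A CURRENCY, NOT THE MECHANISM.  Width seat k0-s3-w2 g2 KERNEL-CHECKED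
(p612426 `Theorems/BalabanUVNodesK0Stub3FinVolPeriodicity.lean`, bus pub-ymgap I.30390 ∕ I.30980; accepted likewise by node00-def-W1 g35 I.31046 for its own `∀ K` letters) that
§4's finite-volume currencies `FinVolDecayOnBoxAt` ∕ `FinVolAbsMomentOnBoxAt` — K-UNIFORM bounds in the ℤ⁴-distance of the UNWRAPPED window `polWindow F K …` — force
`β₁₃ ≡ 0` on the window: `siteOfInt F K j z` is ℤ⁴-PERIODIC (period `2L^{m+K−j}`, `polWindow_add_period`), and a periodic function with an `ℓ¹`∕exponential bound on all of ℤ⁴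
vanishes; so every windowed kernel is `0`, so is its (1.21) limit, so is (1.22).  Print's (5.10) ([I] p.293) is a TORUS-distance statement; my typing unwrapped it.  CONSEQUENCE:
§4's roads `absBox_of_finVolDecay_polLimit` ∕ `absBox_of_finVolAbsMoment_polLimit` and §4b's `absBetaBoxGen_of_finVolDecay_polLimit` ∕ `absBetaBoxGen_of_finVolAbsMoment_polLimit`
are correct theorems inhabited only where `β₁₃ ≡ 0` — they are STRUCK FROM THE LINE (kept as text; §6.1 re-derives the negative control ON MY OWN PREDICATES by name, so the
record shows exactly which decls are vacuous).  THE REPAIR (§6.2–§6.3) types the finite-volume deliverable in node00-def-W1's EVENTUAL currency — `PolLimitsExistOfRecord₁₃ F N θ`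
(= K4) + eventually-in-K ONE-constant windowed (5.10)-decay `EvWindowedDecayOnBoxAt` (for fixed `z` the torus eventually contains `z` in its fundamental domain, where torus
distance = `|z|₁`, so print's (5.10) inhabits it and it forces nothing) — and reaches 3ᴬ′ and K0⁷ BY NAME through k0-s3-w1's p608074 `K0Stub3RunwiseSuppliers`
(`kernelDecayWindowUniform_of_windowedUniform_of_polLimitsExist` → `absBetaBoxGenAt_of_kernelDecayWindowUniformAt` → `K0V19Stub2Prime.record13SepCoPHInhabited_of_stub1_stub3A'_byName`).
k0-s3-w2's FILE 2 `K0Stub3FinVolFace` (fundamental-domain form; p613354 ✓ 07:43Z, commit 644b2c9d8a41) IS the K-UNIFORM twin: §6.4 cites it BY NAME (`FundDomDecayOnBoxAt` = print's (5.10)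
read on the torus, for EVERY K; `absBox_of_fundDomDecayOnBoxAt`, `evWindowedDecayOnBoxAt_of_fundDomDecayOnBoxAt`, `polLimitExistsOnBoxAt_iff_box` = my K4 stub IS W1's box letter, `Iff.rfl`).
What K1b must deliver is therefore print's (5.10) IN TORUS DISTANCE with constants free of `K`, `k` and the history — the mechanism of §1 (fine-jet heredity × convex mixing) and
its prices are untouched; the moment-form shortcut (ed.1's «K0 needs only absolute summability») survives only in its eventual∕limiting-kernel reading.

WHAT CHANGED SINCE EDITION 2 (edition 3, g8).
* C3 — CRIT-2's falsifier of the super-step re-cut RUN (Gaussian caricature; seat NOTES.md `## C3 falsifier`).  Outcome: (i) the SEPARATE ⟨Hess⟩ and Cov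
  halves of the letter of an `s`-fold composed term each grow like `L^{2s}` (seagull `G_s(x,x)·b²` and current–current quadratic divergence; the lattice Ward
  identity cancels them only in the SUM), so (α′) is FALSE for the letters edition 2 transported; (ii) the load-bearing cross term is always (YOUNGEST old
  term) × (FINEST new fluctuation) — adjacent scales whatever `s` is — so the super-step gain `L^{−2s}` never multiplies it.  Edition 2's §1 lemmas were true
  and MISAPPLIED.  THE SUPER-STEP RE-CUT IS WITHDRAWN.
  WHAT REPLACES IT (§1) — and dissolves (α), (α′), C3 at the root.  Print's inductive letters ([I] (0.24)–(0.25) p.257: «E^{(j)}(X, U) are analytic gauge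
  invariant functions of U [the FINE ε-lattice field] depending on U restricted to X») are jets of FIXED functions of the FINE field, evaluated later at new
  arguments and never re-bounded.  Editions 1–2 and the round-2 exchange parametrised old terms through the COARSE field, `V ↦ E^{(j)}(X, U_k(V))`; that is the
  only place a minimiser-response constant (ed.1's `C_*`, «`B₃ ⊇ 2L²`») entered the per-slot factor.  In the fine-field organisation the step replaces the
  argument `U` by the fluctuation map `𝒰(ξ; U)` (standardised product-measure variable `ξ`, [Dim] pp.17–19 `𝒲_k = a_kG_kQ_k^T C_k^{1/2} W`; off the minimiser
  manifold the extension is chosen with `𝒰(0; U) = U`), so `∂_U 𝒰 = Id + O(g_k p(g_k))·([15] §G response operators)`: the [15] constants sit INSIDE the `O(g)`.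
  New generation-`(k+1)` terms sourced by an old term are `T_j := E_ξ[V^{(j)}∘𝒰] − V^{(j)}` (+ `g`-suppressed higher cumulants); ONLY the top retained order
  `N` has a non-`g`-suppressed piece — a DIFFERENCE of two `N`-th derivatives at `g`-close base points, factor 2, per-slot factor `c = 1 + O(gp)` — lower
  orders are slaved to the top one by REAL Taylor (`E ξ = 0` kills the linear term; `V^{(j)}` vanishes to the marginal order at the trivial configuration after
  WT extraction, (0.28)–(0.30)).  Scale conversion of directions is kinematic, in PRINT'S OWN COUNT ((0.27)–(0.29) p.258: on a cube,
  `U_k = exp(iηH)` in the [15] Sect. F coordinates, «expand in H up to the fifth order», `|ηH| = O(L^jη)` per order = AMPLITUDE counting): per slot `L^{−Δj}`,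
  volume `L^{4Δj}`, order `n` scales `L^{(4−n)Δj}` (`n ≤ 4` relevant∕marginal → WT extraction of `β·A(exp iηH)` with remainders of 5th-order size; `n ≥ 5`
  irrelevant).  Hence the top-letter renewal `â_{k+1} ≤ M_fresh + ρ_N·max_{j≤k} â_j + g_k p(g_k)·Φ(max â)`, `ρ_N = 2K₀(1 + cg_k)^N ∕ (L^{N−4} − 1)`,
  `K₀ = Σ_{X∋0} e^{−κd(X)}∕|X| = 1 + O(e^{−κ∕2})` the localisation-domain counting constant: at print's order `N = 5`, `ρ₅ < 1 ⟺ 2K₀(1+cg)⁵ < L − 1`, implied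
  by `< 12` (`amplitudeN5_of_lt_12`; margin modest); at `N = 6`, `ρ₆ < 1 ⟺ 2K₀(1+cg)⁶ < L² − 1`, implied by `< 168` (`amplitudeN6_of_lt_168`; margin ≈ 40×) —
  so the induction carries 6-JETS (a `C⁶` class: the finiteness, not the number, is the point; the SOCKET reads order 2), with no [15] constant in `ρ`, no
  `L`-growth, no compounding (each term is born once).  Edition 1's literal `2C_*³ < L² − 1` (COVARIANT counting, per slot `L^{−2Δj}`, `covariantN3_of_lt_168`)
  is the OPTIMISTIC variant, conditional on a slot-wise covariant Ward reduction at non-trivial base points that is NOT claimed here.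
  β's old-term feed (what 3ᴬ′ reads): `|E[D²V^{(j)}(𝒰) − D²V^{(j)}(U)]| ≤ gp·L^{−Δj}·â_j`
  (the fluctuation slot is fine-scale) ⇒ `|β_{k+1} − fresh| ≤ g_k p(g_k)·max â ∕ (L − 1)`, uniformly: 3ᴬ′'s `β′`.  The coarse read-out (β of record is a
  COARSE-field Hessian of the merged term through `U_{k+1}(W)`) costs ≤ 3 response constants ONCE at the end.
  §1 PROVES the bookkeeping for a general per-slot factor `c` and the DICHOTOMY `finiteOrder_closes_iff` «some finite order contracts ⟺ `c < B`» — read as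
  the PRICE OF THE PARAMETRISATION (barrier note BN-O3): fine-field letters `c = 1 + O(gp) < L` close at some finite order on every admissible family (at `N = 6`
  with margin, at print's `N = 5` tightly); coarse-field letters `c = C_resp` close iff `C_resp < L` (amplitude) ∕ `< L²` (covariant).  THE HONEST RESIDUAL of the real class (replaces (α′); seat NOTES.md):
  (R1) the INTRA-STEP cluster expansion without analyticity in decoupling parameters — real `s`-interpolation loses derivatives (tree vertices of unbounded
  degree), so it must go by FINITE-RANGE DECOMPOSITION of the one-step fluctuation covariance `Δ(U)^{-1}` (positive, finite-range, `U`-uniform gap) +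
  independence-based polymer expansion with sup-norm activities (Bauerschmidt 2013 doi:10.1007/s00440-012-0471-y; Runa arXiv:1510.07604 for variable
  coefficients; AKM arXiv:1202.1158; BBS arXiv:1403.7256) — `U`-derivatives pass through `Γ_ℓ^{1/2}(U)ξ` by first-order chain rule, no loss; (R2) WT
  extraction at the marginal order in real Taylor form ((β)); (R3) [15] §G REAL part (a `C^N` local branch of minimisers + response bounds to order `N`; §5 shows the selector is immaterial);
  (R4) the bootstrap (§2); (R5) the coarse read-out.
* C4 — CONCEDED as asked: no `T`-uniform affine renewal; the BOOTSTRAP is typed and PROVED (§2 `bootstrap_uniform_bound`): `Â_{K+1} ≤ M + ρ·S + g_K·Φ(S)` for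
  every bound `S` of the past, `ρ ∈ [0,1)`, `Φ` monotone, `0 ≤ g_K ≤ γ₀ := 1 ∕ max 1 (Φ T⋆)`, `T⋆ := (M+1) ∕ (1−ρ)` ⟹ `∀ K, Â_K ≤ T⋆`.
* C5 — ANSWERED BY A PROOF (§5): the merged term `mergedTermT … k W` equals `A_{k+1}(W) − A_k(Ū^k U₀)` for EVERY background `U₀` of `W`, given
  `UniqueUkOrbit F N K (k+1) ε W` ([15] Thm 1 uniqueness) and `HInvT F N T χ K g (k+1)` ([I] (0.24) invariance) — both hypotheses the record's own
  telescoping already names (`BackgroundActionT`).  So `Classical.choose` in `Uk` is harmless: K3's open content is a smooth ∕ analytic local BRANCH of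
  minimisers on the window ([15] §G) + differentiation under the compact Haar fibre integral, nothing about the selector.
* §2–§4 of edition 2 (here §3, §4, §4b: K3 junk road; K4 = `PolLimitExistsOnBoxAt` as FIRST stub; `ChartC2OnBoxAt`; the two finite-volume roads; the socket concluders
  `absBetaBoxGen_of_finVolDecay_polLimit` ∕ `absBetaBoxGen_of_finVolAbsMoment_polLimit` reaching `K0V19Defs.AbsBetaBoxAtThm1WitnessCCMGenAt F` BY NAME)
  are KEPT VERBATIM (CRIT-2 verified them; they are where K4 enters and what a line's last step looks like).  [Edition 4: the two `FinVol…OnBoxAt` currencies and the four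
  roads through them are STRUCK from the line by E-g11 (§6) — vacuous off `β₁₃ ≡ 0`; `PolLimitExistsOnBoxAt`, `ChartC2OnBoxAt`, §3 and the generic §4 lemmas are unaffected.]

HONEST FRAMING.  Hypothesis SHAPES, elementary real-analysis lemmas and by-name bookkeeping; NOTHING of Bałaban is asserted or proved; K0⁷ stmt-QuantumFields-20541
is OPEN (V19 87879403b3a26109: stub 2′ landed p595104, stubs 1 and 3ᴬ′ open — 3ᴬ′'s consumer faces 3ᴿ ∕ 3ᶜ ∕ box-of-letters landed by k0-s3-w1∕w2 are junctions, not closers); the Yang–Mills mass gap (Clay) is NOT proved by any of this; route R4 `BalabanUVNodes` closes only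
the CONDITIONAL finite-𝕋⁴ rung `BalabanLadder.UV`; [I] Thm 2 ∕ (0.31) p.259 is unproved in print.  No `sorry`, no `instance`, no `notation`; standard axioms.
-/

noncomputable section

open scoped Matrix.Norms.L2Operator
open Filter Topology

namespace YMNodeOIdeate.Idea6.HessCovK0v3

open Literature.MathematicalPhysics.QuantumFieldTheory.Balaban1983to89
open Literature.MathematicalPhysics.QuantumFieldTheory.Balaban1983to89.T4Continuum
open Literature.MathematicalPhysics.QuantumFieldTheory.Balaban1983to89.Node00
open Literature.MathematicalPhysics.QuantumFieldTheory.Balaban1983to89.FlowStep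
open Literature.MathematicalPhysics.QuantumFieldTheory.Balaban1983to89.B12Sec2to5 (Decay510 secondMoment_abs_le_of_decay510 betaPrime510)
open Summit.QuantumFields.YangMills.Theorems.K0V19Defs (AbsBetaBoxAtThm1WitnessCCMGenAt)

/-! ## §1. THE FINITE-ORDER JET INDUCTION (answers C3): top-order renewal coefficient and the dichotomy `(∃ N contracting) ⟺ c < B`

`B` = the per-generation base of the irrelevance gain (`B = L²`, shift `d = 2`: covariant counting — each slot a field strength, [I] (0.27)–(0.30); `B = L`, shift
`d = 4`: amplitude counting), `c` = the per-slot factor of the map through which old terms see the new variable (`c = 1 + O(g p(g))` for FINE-field letters,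
print's (0.24) organisation; `c = C_resp`, a [15]-type minimiser-response constant, for COARSE-field letters — editions 1–2), `a = 2K₀ ≥ 1` (the factor 2 of
the un-Taylorable top-order difference × the localisation-domain counting constant `K₀ ≥ 1`).  The top-order letter renewal is
`Â_{K+1} ≤ M + (a c^N ∕ (B^{N−d} − 1))·max_{J≤K} Â_J + (g-suppressed)`, and it contracts iff `a c^N < B^{N−d} − 1`. -/

/-- The top-order renewal coefficient `ρ_N = a·c^N ∕ (B^{N−d} − 1)` of the order-`N` jet heredity. [cite: Balaban1987RG1, (0.27) p.258 (the `(L^jη)^{n−4}` gain)] -/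
def rhoTop (a c B : ℝ) (d N : ℕ) : ℝ := a * c ^ N / (B ^ (N - d) - 1)

/-- `ρ_N < 1 ⟺ a c^N < B^{N−d} − 1` (the denominator is positive for `N > d`, `B > 1`). [folklore] -/
theorem rhoTop_lt_one_iff {a c B : ℝ} {d N : ℕ} (hB : 1 < B) (hN : d < N) :
    rhoTop a c B d N < 1 ↔ a * c ^ N < B ^ (N - d) - 1 := by
  have hpos : 0 < B ^ (N - d) - 1 := sub_pos.mpr (one_lt_pow₀ hB (Nat.sub_ne_zero_of_lt hN))
  unfold rhoTop
  rw [div_lt_one hpos]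

/-- **No finite order contracts when `c ≥ B`** (`a ≥ 1`): `B^{N−d} − 1 < B^N ≤ c^N ≤ a c^N`. [folklore] -/
theorem not_contracts_of_le {a c B : ℝ} {d N : ℕ} (hB : 1 < B) (ha : 1 ≤ a) (hc : B ≤ c) :
    ¬ (a * c ^ N < B ^ (N - d) - 1) := by
  intro h
  have h1 : B ^ (N - d) ≤ B ^ N := pow_le_pow_right₀ hB.le (Nat.sub_le N d)
  have h2 : B ^ N ≤ c ^ N := pow_le_pow_left₀ (by linarith) hc N
  have h3 : (0:ℝ) ≤ c ^ N := pow_nonneg (by linarith) N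
  nlinarith [mul_le_mul_of_nonneg_right ha h3]

/-- **Some finite order contracts when `0 ≤ c < B`** (`a ≥ 1`): `(max c 1 ∕ B)^N → 0`. [folklore] -/
theorem exists_order_of_lt {a c B : ℝ} (d : ℕ) (hB : 1 < B) (ha : 1 ≤ a) (hc₀ : 0 ≤ c) (hc : c < B) :
    ∃ N, d < N ∧ a * c ^ N < B ^ (N - d) - 1 := by
  have hB₀ : 0 < B := lt_trans one_pos hB
  set m := max c 1 with hm
  have hm₁ : 1 ≤ m := le_max_right _ _
  have hmB : m < B := max_lt hc hB
  have hm₀ : 0 < m := lt_of_lt_of_le one_pos hm₁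
  have hr₀ : 0 ≤ m / B := div_nonneg hm₀.le hB₀.le
  have hr₁ : m / B < 1 := (div_lt_one hB₀).mpr hmB
  have ha₀ : 0 < a + 1 := by linarith
  have hε : 0 < 1 / ((a + 1) * B ^ d) := by positivity
  obtain ⟨N, hN₁, hN₂⟩ := (((tendsto_pow_atTop_nhds_zero_of_lt_one hr₀ hr₁).eventually (Iio_mem_nhds hε)).and
    (eventually_gt_atTop d)).exists
  refine ⟨N, hN₂, ?_⟩
  have hBN : 0 < B ^ N := pow_pos hB₀ N
  have hBd : 0 < B ^ d := pow_pos hB₀ d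
  have h1 : m ^ N / B ^ N < 1 / ((a + 1) * B ^ d) := by rw [← div_pow]; exact hN₁
  rw [div_lt_div_iff₀ hBN (by positivity), one_mul] at h1
  have h2 : c ^ N ≤ m ^ N := pow_le_pow_left₀ hc₀ (le_max_left _ _) N
  have h3 : (1:ℝ) ≤ m ^ N := one_le_pow₀ hm₁
  have h4 : a * c ^ N + 1 ≤ (a + 1) * m ^ N := by nlinarith [mul_le_mul_of_nonneg_left h2 (by linarith : (0:ℝ) ≤ a)]
  have h5 : (a * c ^ N + 1) * B ^ d ≤ (a + 1) * m ^ N * B ^ d := mul_le_mul_of_nonneg_right h4 hBd.le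
  have h6 : (a + 1) * m ^ N * B ^ d = m ^ N * ((a + 1) * B ^ d) := by ring
  rw [h6] at h5
  rw [pow_sub₀ _ hB₀.ne' hN₂.le, ← div_eq_mul_inv, lt_sub_iff_add_lt, lt_div_iff₀ hBd]
  linarith

/-- **THE DICHOTOMY (barrier note BN-O3 «price of the parametrisation», typed)**: for `a ≥ 1`, `0 ≤ c`, `B > 1`, some finite order `N > d` makes the
top-order renewal contract IFF `c < B`.  Fine-field letters (`c = 1 + O(gp) < B` trivially) always close; coarse-field letters close iff their response
constant is `< L²` (covariant) ∕ `< L` (amplitude) — otherwise only analyticity (`N = ∞`, Cauchy) rescues that parametrisation.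
[cite: Balaban1987RG1, (0.24)–(0.25) p.257, (0.27)–(0.30) p.258; Balaban1985Variational, §G (174), (179), (182) pp.305–307] -/
theorem finiteOrder_closes_iff {a c B : ℝ} (d : ℕ) (hB : 1 < B) (ha : 1 ≤ a) (hc₀ : 0 ≤ c) :
    (∃ N, d < N ∧ a * c ^ N < B ^ (N - d) - 1) ↔ c < B := by
  constructor
  · rintro ⟨N, -, h⟩
    by_contra hle
    exact not_contracts_of_le (d := d) (N := N) hB ha (not_lt.mp hle) h
  · exact exists_order_of_lt d hB ha hc₀

/-- The same through `rhoTop`. [folklore] -/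
theorem exists_rhoTop_lt_one_iff {a c B : ℝ} (d : ℕ) (hB : 1 < B) (ha : 1 ≤ a) (hc₀ : 0 ≤ c) :
    (∃ N, d < N ∧ rhoTop a c B d N < 1) ↔ c < B := by
  rw [← finiteOrder_closes_iff d hB ha hc₀]
  exact exists_congr fun N => and_congr_right fun hN => rhoTop_lt_one_iff hB hN

/-- **AMPLITUDE COUNTING ON AN ADMISSIBLE FAMILY** (`L ≥ 13`): some order `N ≥ 5` closes iff the per-slot factor is `< L`. [cite: Balaban1987RG1, (0.27) p.258] -/
theorem jetAmplitude_closes_iff (F : T4Family) {a C : ℝ} (ha : 1 ≤ a) (hC : 0 ≤ C) :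
    (∃ N, 4 < N ∧ a * C ^ N < (F.L : ℝ) ^ (N - 4) - 1) ↔ C < F.L :=
  finiteOrder_closes_iff 4 (by exact_mod_cast F.hL.2) ha hC

/-- **COVARIANT COUNTING** (each slot a field strength; base `L²`, shift 2; `N = 3` is edition 1's `2C_*³ < L² − 1`): some order `N ≥ 3` closes iff the
per-slot factor is `< L²`. [cite: Balaban1987RG1, (0.27)–(0.30) p.258] -/
theorem jetCovariant_closes_iff (F : T4Family) {a C : ℝ} (ha : 1 ≤ a) (hC : 0 ≤ C) :
    (∃ N, 2 < N ∧ a * C ^ N < ((F.L : ℝ) ^ 2) ^ (N - 2) - 1) ↔ C < (F.L : ℝ) ^ 2 := by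
  have hL : (1 : ℝ) < F.L := by exact_mod_cast F.hL.2
  exact finiteOrder_closes_iff 2 (by nlinarith) ha hC

/-- Edition 1's single-step cut is the `N = 3` covariant rung: `((L²)^(3−2) − 1) = L² − 1`. [folklore] -/
example (F : T4Family) (C : ℝ) : (2 * C ^ 3 < ((F.L : ℝ) ^ 2) ^ (3 - 2) - 1) ↔ (2 * C ^ 3 < (F.L : ℝ) ^ 2 - 1) := by norm_num

/-- Admissible families have `L ≥ 13` (`Odd L ∧ 11 < L`). [cite: Balaban1987RG1, (0.6) p.251 (the blocking factor; bookkeeping)] -/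
theorem thirteen_le_L (F : T4Family) : 13 ≤ F.L := by
  obtain ⟨m, hm⟩ := F.hL.1
  have h11 := F.hL11
  omega

/-- Hence `168 ≤ L² − 1` on every admissible family. [folklore] -/
theorem le_sq_L_sub_one (F : T4Family) : (168 : ℝ) ≤ (F.L : ℝ) ^ 2 - 1 := by
  have h : (13 : ℝ) ≤ F.L := by exact_mod_cast thirteen_le_L F
  nlinarith

/-- **EDITION 1's (2,1)-CUT IN THE FINE-FIELD ORGANISATION**: with per-slot factor `c` (`= 1 + O(g p(g))`) and `a = 2K₀`, the covariant `N = 3` renewal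
contracts on EVERY admissible family as soon as `a c³ < 168` — e.g. `K₀ ≤ 3`, `c ≤ 3` gives `2·3·27 = 162 < 168`.  No [15] constant, no `L`-growth condition.
[cite: Balaban1987RG1, (0.24)–(0.25) p.257 and (0.27)–(0.30) p.258] -/
theorem covariantN3_of_lt_168 (F : T4Family) {a c : ℝ} (h : a * c ^ 3 < 168) :
    a * c ^ 3 < ((F.L : ℝ) ^ 2) ^ (3 - 2) - 1 := by
  have := le_sq_L_sub_one F
  norm_num
  linarith

/-- Numerical instance: `K₀ = 3`, `c = 3` (far above `1 + O(gp)`) still contracts at `N = 3`. [folklore] -/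
example (F : T4Family) : (2 * 3) * (3 : ℝ) ^ 3 < ((F.L : ℝ) ^ 2) ^ (3 - 2) - 1 :=
  covariantN3_of_lt_168 F (by norm_num)

/-- `12 ≤ L − 1` on every admissible family. [folklore] -/
theorem twelve_le_L_sub_one (F : T4Family) : (12 : ℝ) ≤ (F.L : ℝ) - 1 := by
  have h : (13 : ℝ) ≤ F.L := by exact_mod_cast thirteen_le_L F
  linarith

/-- **PRINT'S ORDER, AMPLITUDE COUNTING** ([I] (0.27)–(0.29): «expand in H up to the fifth order»; base `L`, shift 4): the `N = 5` top-letter renewal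
contracts on every admissible family as soon as `a c⁵ < 12`, e.g. `K₀ ≤ 2`, `(1+cg)⁵ ≤ 2` gives `8 < 12` — margin modest.
[cite: Balaban1987RG1, (0.27)–(0.29) p.258] -/
theorem amplitudeN5_of_lt_12 (F : T4Family) {a c : ℝ} (h : a * c ^ 5 < 12) :
    a * c ^ 5 < (F.L : ℝ) ^ (5 - 4) - 1 := by
  have := twelve_le_L_sub_one F
  norm_num
  linarith

/-- **ONE ORDER ABOVE PRINT, AMPLITUDE COUNTING** (`N = 6`, base `L`, shift 4): contracts as soon as `a c⁶ < 168` — e.g. `K₀ ≤ 3`, `(1+cg)⁶ ≤ 4` gives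
`24 < 168`; the recommended top order of the real induction (a `C⁶` class; the socket reads order 2). [cite: Balaban1987RG1, (0.27)–(0.30) p.258] -/
theorem amplitudeN6_of_lt_168 (F : T4Family) {a c : ℝ} (h : a * c ^ 6 < 168) :
    a * c ^ 6 < (F.L : ℝ) ^ (6 - 4) - 1 := by
  have := le_sq_L_sub_one F
  norm_num
  linarith

/-- Numerical instance at `N = 6`: `K₀ = 3`, `(1+cg)⁶ ≤ 4` (i.e. `1 + cg ≤ 4^{1/6} ≈ 1.26`). [folklore] -/
example (F : T4Family) {c : ℝ} (hc : c ^ 6 ≤ 4) : (2 * 3) * c ^ 6 < (F.L : ℝ) ^ (6 - 4) - 1 :=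
  amplitudeN6_of_lt_168 F (by nlinarith)

/-- **THE TOP-ORDER RENEWAL CLOSES WHEN IT CONTRACTS** (edition 2's `superStep_closure`, kept under its honest name: it is the renewal lemma for the ONE
non-`g`-suppressed letter; the `g`-suppressed ones go through §2). [folklore] -/
theorem topOrder_closure {A : ℕ → ℝ} {M ρ : ℝ} (hρ₁ : ρ < 1)
    (h : ∀ K T, (∀ J ≤ K, A J ≤ T) → A (K + 1) ≤ M + ρ * T) :
    ∀ K, A K ≤ max (A 0) (M / (1 - ρ)) := by
  set T := max (A 0) (M / (1 - ρ)) with hT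
  have h1ρ : 0 < 1 - ρ := by linarith
  have hMT : M + ρ * T ≤ T := by
    have : M / (1 - ρ) ≤ T := le_max_right _ _
    rw [div_le_iff₀ h1ρ] at this
    linarith
  have key : ∀ K, ∀ J ≤ K, A J ≤ T := by
    intro K
    induction K with
    | zero => intro J hJ; rw [Nat.le_zero.mp hJ]; exact le_max_left _ _
    | succ K ih =>
      intro J hJ
      rcases Nat.lt_or_ge J (K + 1) with hlt | hge
      · exact ih J (Nat.lt_succ_iff.mp hlt)
      · rw [le_antisymm hJ hge]; exact (h K T ih).trans hMT
  exact fun K => key K K le_rfl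

/-! ## §2. C4 — THE BOOTSTRAP, typed and proved (answers CRIT-2 ROUND-2 C4 in the conceded form)

All `g`-suppressed contributions (lower orders' fluctuation-Taylor terms, the cumulants `κ_m`, the convexity constant perturbed by the old sheds) are lumped into
`g_K · Φ(S)` with `Φ` monotone in the running bound `S` of the past; the non-suppressed top-order cross term is `ρ·S`, `ρ < 1` (§1). -/

/-- **BOOTSTRAP**: if `Â₀ ≤ M`, `0 ≤ g_K ≤ γ₀` and `Â_{K+1} ≤ M + ρ S + g_K Φ(S)` for every bound `S` of `Â₀ … Â_K`, with `0 ≤ ρ < 1` and `Φ` monotone, then for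
`γ₀ := 1 ∕ max 1 (Φ T⋆)`, `T⋆ := (M + 1) ∕ (1 − ρ)`: `∀ K, Â_K ≤ T⋆`.  (`γ₀`, `T⋆` depend on `M, ρ, Φ` only — this is where the bound on `g` of the window
]0, γ₀] is born.)  Every-bound form (no monotonicity needed); the running-maximum form for monotone `Φ` is `bootstrap_uniform_bound_max`. [folklore] -/
theorem bootstrap_uniform_bound {M ρ : ℝ} (hM : 0 ≤ M) (hρ₀ : 0 ≤ ρ) (hρ₁ : ρ < 1) (Φ : ℝ → ℝ) :
    ∃ γ₀ T : ℝ, 0 < γ₀ ∧ M ≤ T ∧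
      ∀ (A g : ℕ → ℝ), A 0 ≤ M → (∀ K, 0 ≤ g K ∧ g K ≤ γ₀) →
        (∀ K S, (∀ J ≤ K, A J ≤ S) → A (K + 1) ≤ M + ρ * S + g K * Φ S) → ∀ K, A K ≤ T := by
  set T := (M + 1) / (1 - ρ) with hT
  have h1ρ : 0 < 1 - ρ := by linarith
  have h1ρ' : 1 - ρ ≠ 0 := h1ρ.ne'
  have hTM : M ≤ T := by
    rw [hT, le_div_iff₀ h1ρ]
    nlinarith [mul_nonneg hM hρ₀]
  have hmax : 0 < max 1 (Φ T) := lt_of_lt_of_le one_pos (le_max_left _ _)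
  refine ⟨1 / max 1 (Φ T), T, by positivity, hTM, ?_⟩
  intro A g hA0 hg hrec
  have hρT : M + ρ * T + 1 = T := by
    rw [hT]
    field_simp
    ring
  have key : ∀ K, ∀ J ≤ K, A J ≤ T := by
    intro K
    induction K with
    | zero => intro J hJ; rw [Nat.le_zero.mp hJ]; exact hA0.trans hTM
    | succ K ih =>
      intro J hJ
      rcases Nat.lt_or_ge J (K + 1) with hlt | hge
      · exact ih J (Nat.lt_succ_iff.mp hlt)
      · rw [le_antisymm hJ hge]
        have hstep := hrec K T ih
        have hgΦ : g K * Φ T ≤ 1 := by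
          rcases le_or_gt 0 (Φ T) with hΦ0 | hΦ0
          · calc g K * Φ T ≤ (1 / max 1 (Φ T)) * Φ T := mul_le_mul_of_nonneg_right (hg K).2 hΦ0
              _ ≤ (1 / max 1 (Φ T)) * max 1 (Φ T) := mul_le_mul_of_nonneg_left (le_max_right _ _) (by positivity)
              _ = 1 := one_div_mul_cancel hmax.ne'
          · nlinarith [(hg K).1, mul_nonneg (hg K).1 (neg_pos.mpr hΦ0).le]
        linarith
  exact fun K => key K K le_rfl

/-- **THE NATURAL (running-maximum) FORM ⟹ the every-bound form**, for MONOTONE `Φ` and `ρ, g_K ≥ 0`: if each step is controlled by the LEAST bound `P_K`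
of the past (`P_K = max_{J≤K} Â_J`), it is controlled by every bound `S ≥ P_K`.  This is where monotonicity of `Φ` is consumed. [folklore] -/
theorem forallBound_of_leastBound {A g : ℕ → ℝ} {M ρ : ℝ} (hρ₀ : 0 ≤ ρ) {Φ : ℝ → ℝ} (hΦ : Monotone Φ) (hg : ∀ K, 0 ≤ g K)
    (h : ∀ K, ∃ P, (∀ J ≤ K, A J ≤ P) ∧ (∀ S, (∀ J ≤ K, A J ≤ S) → P ≤ S) ∧ A (K + 1) ≤ M + ρ * P + g K * Φ P) :
    ∀ K S, (∀ J ≤ K, A J ≤ S) → A (K + 1) ≤ M + ρ * S + g K * Φ S := by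
  intro K S hS
  obtain ⟨P, -, hPle, hA⟩ := h K
  have hPS : P ≤ S := hPle S hS
  have h1 : ρ * P ≤ ρ * S := mul_le_mul_of_nonneg_left hPS hρ₀
  have h2 : g K * Φ P ≤ g K * Φ S := mul_le_mul_of_nonneg_left (hΦ hPS) (hg K)
  linarith

/-- **BOOTSTRAP, running-maximum form** (the form K1–K2 actually deliver): monotone `Φ`, `0 ≤ ρ < 1`, `0 ≤ g_K ≤ γ₀`. [folklore] -/
theorem bootstrap_uniform_bound_max {M ρ : ℝ} (hM : 0 ≤ M) (hρ₀ : 0 ≤ ρ) (hρ₁ : ρ < 1) {Φ : ℝ → ℝ} (hΦ : Monotone Φ) :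
    ∃ γ₀ T : ℝ, 0 < γ₀ ∧ M ≤ T ∧
      ∀ (A g : ℕ → ℝ), A 0 ≤ M → (∀ K, 0 ≤ g K ∧ g K ≤ γ₀) →
        (∀ K, ∃ P, (∀ J ≤ K, A J ≤ P) ∧ (∀ S, (∀ J ≤ K, A J ≤ S) → P ≤ S) ∧ A (K + 1) ≤ M + ρ * P + g K * Φ P) →
          ∀ K, A K ≤ T := by
  obtain ⟨γ₀, T, hγ₀, hMT, h⟩ := bootstrap_uniform_bound hM hρ₀ hρ₁ Φ
  exact ⟨γ₀, T, hγ₀, hMT, fun A g hA0 hg hrec =>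
    h A g hA0 hg (forallBound_of_leastBound hρ₀ hΦ (fun K => (hg K).1) hrec)⟩

/-! ## §3 (edition 2 §2, kept verbatim). K3's JUNK ROAD, as a checked statement: no `C²` content ⇒ `Π ≡ 0` (so a K3 stub must carry `ContDiffAt ℝ 2 (expChart 𝓝 ρ) 0`) -/

section Junk

variable {Λ T V : Type*} [Fintype Λ] [Fintype T] [DecidableEq Λ] [DecidableEq T] [NormedAddCommGroup V] [NormedSpace ℝ V]

omit [Fintype Λ] [Fintype T] in
/-- If the first derivative of the chart is not differentiable at `0`, the polarisation tensor (1.20) is the junk value `0`.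
[cite: Balaban1987RG1, (1.20) p.264 (junk-value bookkeeping)] -/
theorem polTensor_eq_zero_of_not_differentiableAt {𝓔 : (Λ → T → V) → ℝ} (h : ¬ DifferentiableAt ℝ (fderiv ℝ 𝓔) 0)
    (μ : Λ) (x : T) (v : V) (ν : Λ) (y : T) (w : V) :
    B12PolarizationTensor120.polTensor ℝ 𝓔 μ x v ν y w = 0 := by
  rw [B12PolarizationTensor120.polTensor_def, fderiv_zero_of_not_differentiableAt h]
  rfl

omit [Fintype Λ] [Fintype T] in
/-- If the chart is not differentiable on a neighbourhood of `0` (e.g. nowhere differentiable), its `fderiv` vanishes near `0` and again `Π ≡ 0`.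
[cite: Balaban1987RG1, (1.20) p.264 (junk-value bookkeeping)] -/
theorem polTensor_eq_zero_of_fderiv_eventuallyEq_zero {𝓔 : (Λ → T → V) → ℝ} (h : fderiv ℝ 𝓔 =ᶠ[𝓝 0] 0)
    (μ : Λ) (x : T) (v : V) (ν : Λ) (y : T) (w : V) :
    B12PolarizationTensor120.polTensor ℝ 𝓔 μ x v ν y w = 0 := by
  rw [B12PolarizationTensor120.polTensor_def, h.fderiv_eq]
  simp

end Junk

/-! ## §4 (edition 2 §3, kept verbatim). K4 = `PolLimitExists` AS THE FIRST STUB, typed against the record, and its two uses (PROVED) -/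

section LimitGeneric

variable {𝔄 : Type*} [NormedRing 𝔄] [NormedAlgebra ℝ 𝔄] {V : Type*} [NormedAddCommGroup V] [NormedSpace ℝ V] {ι : Type*} [Fintype ι]

/-- **Use 1 — limits inherit pointwise decay**: K-uniform (5.10)-decay of the windowed finite-volume kernels + existence of the limit ⟹ (5.10)-decay of `polLimit`.
[cite: Balaban1987RG1, (1.21) p.264 and (5.10) p.293] -/
theorem decay510_polLimit_of_finVol (F : T4Family) (j : ℕ) (ℰ : (K : ℕ) → (Fin (F.P K).d → Site (F.P K) j → 𝔄) → ℝ)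
    (ρ : V →L[ℝ] 𝔄) (bV : Module.Basis ι ℝ V) (μ ν : Fin 4) {C δ₁ : ℝ} (hL : PolLimitExists F j ℰ ρ bV)
    (hK : ∀ K, Decay510 (fun z => polWindow F K j (ℰ K) ρ bV μ ν z) C δ₁) :
    Decay510 (polLimit F j ℰ ρ bV μ ν) C δ₁ := by
  intro z
  have ht := (tendsto_polLimit F j ℰ ρ bV hL μ ν z).abs
  exact le_of_tendsto' ht fun K => hK K z

/-- **Use 2 — limits inherit absolute weighted-moment bounds (Fatou for sums), WITH summability**: if every finite partial sum of `|Π_K(z) z_μ z_ν|` is `≤ M`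
uniformly in `K` and the limit exists, then (1.22) of the limit kernel converges absolutely and `|β| ≤ M`.  (The `tsum` in `B12Beta.secondMoment` is junk `0` on
non-summable kernels — hence the `Summable` conjunct.) [cite: Balaban1987RG1, (1.21)–(1.22) p.264] -/
theorem abs_secondMoment_polLimit_le_of_finVol (F : T4Family) (j : ℕ) (ℰ : (K : ℕ) → (Fin (F.P K).d → Site (F.P K) j → 𝔄) → ℝ)
    (ρ : V →L[ℝ] 𝔄) (bV : Module.Basis ι ℝ V) (μ ν : Fin 4) {M : ℝ} (hL : PolLimitExists F j ℰ ρ bV)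
    (hM : ∀ K (S : Finset (Fin 4 → ℤ)), ∑ z ∈ S, |polWindow F K j (ℰ K) ρ bV μ ν z * (z μ : ℝ) * (z ν : ℝ)| ≤ M) :
    Summable (fun z : Fin 4 → ℤ => polLimit F j ℰ ρ bV μ ν z * (z μ : ℝ) * (z ν : ℝ)) ∧
      |B12Beta.secondMoment (polLimit F j ℰ ρ bV) μ ν| ≤ M := by
  set f : (Fin 4 → ℤ) → ℝ := fun z => polLimit F j ℰ ρ bV μ ν z * (z μ : ℝ) * (z ν : ℝ) with hf
  -- every finite partial sum of `|f|` is the limit of the finite-volume partial sums, hence `≤ M`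
  have hS : ∀ S : Finset (Fin 4 → ℤ), ∑ z ∈ S, |f z| ≤ M := by
    intro S
    have ht : Tendsto (fun K => ∑ z ∈ S, |polWindow F K j (ℰ K) ρ bV μ ν z * (z μ : ℝ) * (z ν : ℝ)|) atTop
        (𝓝 (∑ z ∈ S, |f z|)) := by
      refine tendsto_finsetSum S fun z _ => ?_
      exact (((tendsto_polLimit F j ℰ ρ bV hL μ ν z).mul_const _).mul_const _).abs
    exact le_of_tendsto' ht fun K => hM K S
  have habs : Summable fun z => |f z| := summable_of_sum_le (fun z => abs_nonneg _) hS
  have hsum : Summable f := habs.of_abs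
  refine ⟨hsum, ?_⟩
  have h1 : |∑' z, f z| ≤ ∑' z, |f z| := by
    have := norm_tsum_le_tsum_norm (f := f) (by simpa [Real.norm_eq_abs] using habs)
    simpa [Real.norm_eq_abs] using this
  have h2 : ∑' z, |f z| ≤ M := habs.tsum_le_of_sum_le hS
  exact h1.trans h2

end LimitGeneric

section AtTheta

variable (F : T4Family) (N : ℕ) [NeZero N]

/-- **K4 AT θ — THE FIRST STUB OF ANY K0 LINE** (CRIT-2 TRIAGE §C2∕K4): the printed limit (1.21) EXISTS for the record's own merged term family at every history of
the window `]0, γ₀]^{k+1}`, every step `k`.  Without it `polLimit` is a junk `limUnder` and 3ᴬ′ is neither provable nor refutable in practice.  A HYPOTHESIS SHAPE;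
never asserted. [cite: Balaban1987RG1, (1.21) p.264 («This limit exists by the localized representation (1.7)»)] -/
def PolLimitExistsOnBoxAt (θ : Stage13Params F N) (γ₀ : ℝ) : Prop :=
  letI := θ.instVβ₁; letI := θ.instVβ₂; letI := θ.instιβ
  ∀ k (v : Fin (k + 1) → ℝ), v ∈ Box γ₀ k →
    PolLimitExists F (k + 1) (fun K => mergedTermFamilyMatT F N (TcanOfRecord F N) (chiFixed29 F N θ.ν θ.ε₂₉) θ.εbg k v K) θ.ρ8 θ.bV

/-- **K3's content AT θ** (CRIT-2: «a K3 stub must carry `DifferentiableAt`-type content, not just the identity»): the chart `B ↦ 𝓝_{k+1}(v; exp ρ8 B)` of every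
finite-volume merged term of the record is `C²` at `B = 0`, on the window — so that (1.20) is the classical Hessian (`polTensor_expChart_swap`), not §2's junk `0`.
A HYPOTHESIS SHAPE (differentiation under the Haar fibre integral, right-translation moving the χ-window into the integrand); never asserted.
[cite: Balaban1987RG1, p.264 (before (1.20)) with (1.9) p.261] -/
def ChartC2OnBoxAt (θ : Stage13Params F N) (γ₀ : ℝ) : Prop :=
  letI := θ.instVβ₁; letI := θ.instVβ₂; letI := θ.instιβ
  ∀ k (v : Fin (k + 1) → ℝ), v ∈ Box γ₀ k → ∀ K,
    ContDiffAt ℝ 2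
      (B12PolarizationTensor120.expChart (mergedTermFamilyMatT F N (TcanOfRecord F N) (chiFixed29 F N θ.ν θ.ε₂₉) θ.εbg k v K) θ.ρ8) 0

/-- **THE FINITE-VOLUME DELIVERABLE OF K1–K3 AT θ, exponential form**: K-UNIFORM (5.10)-decay, constants `(C, δ₁)`, of the record's windowed finite-torus kernels
`Π_K(0,1;·)` on the window, all `k`, all `K`.  (What the super-step heredity is to produce, in finite volume where the identity ∕ BL ∕ convexity act.)
A HYPOTHESIS SHAPE; never asserted. [cite: Balaban1987RG1, (5.10) p.293 and (1.21) p.264] -/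
def FinVolDecayOnBoxAt (θ : Stage13Params F N) (γ₀ C δ₁ : ℝ) : Prop :=
  letI := θ.instVβ₁; letI := θ.instVβ₂; letI := θ.instιβ
  ∀ k (v : Fin (k + 1) → ℝ), v ∈ Box γ₀ k → ∀ K,
    Decay510 (fun z => polWindow F K (k + 1) (mergedTermFamilyMatT F N (TcanOfRecord F N) (chiFixed29 F N θ.ν θ.ε₂₉) θ.εbg k v K) θ.ρ8 θ.bV 0 1 z) C δ₁

/-- **THE FINITE-VOLUME DELIVERABLE, moment form** (K0 needs only absolute summability of the weighted second moment — ed.1's point, kept): K-UNIFORM bound `M` on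
all finite partial sums of `|Π_K(0,1;z) z₀ z₁|` on the window.  A HYPOTHESIS SHAPE; never asserted. [cite: Balaban1987RG1, (1.22) p.264] -/
def FinVolAbsMomentOnBoxAt (θ : Stage13Params F N) (γ₀ M : ℝ) : Prop :=
  letI := θ.instVβ₁; letI := θ.instVβ₂; letI := θ.instιβ
  ∀ k (v : Fin (k + 1) → ℝ), v ∈ Box γ₀ k → ∀ K (S : Finset (Fin 4 → ℤ)),
    ∑ z ∈ S, |polWindow F K (k + 1) (mergedTermFamilyMatT F N (TcanOfRecord F N) (chiFixed29 F N θ.ν θ.ε₂₉) θ.εbg k v K) θ.ρ8 θ.bV 0 1 z *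
        (z 0 : ℝ) * (z 1 : ℝ)| ≤ M

variable (θ : Stage13Params F N)

/-- On the design box the β of record IS the merged β (unfolding + `betaOfMerged_of_mem`). [cite: Balaban1987RG1, (1.22) p.264 (bookkeeping)] -/
theorem betaOfRecord₁₃_eq_merged_of_mem {k : ℕ} {v : Fin (k + 1) → ℝ} (hv : v ∈ Box θ.γ k) :
    betaOfRecord₁₃ F N θ k v =
      (letI := θ.instVβ₁; letI := θ.instVβ₂; letI := θ.instιβ
       betaMerged F (mergedTermFamilyMatT F N (TcanOfRecord F N) (chiFixed29 F N θ.ν θ.ε₂₉) θ.εbg) θ.ρ8 θ.bV k v) := by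
  letI := θ.instVβ₁; letI := θ.instVβ₂; letI := θ.instιβ
  rw [betaOfRecord₁₃_eq_betaOfRecord₈Tχ]
  exact betaOfMerged_of_mem _ _ _ hv

/-- Windows shrink: `]0, γ₀]^{k+1} ⊆ ]0, γ]^{k+1}` for `γ₀ ≤ γ`. [folklore] -/
theorem box_mono {γ₀ γ : ℝ} (hle : γ₀ ≤ γ) {k : ℕ} {v : Fin (k + 1) → ℝ} (hv : v ∈ Box γ₀ k) : v ∈ Box γ k :=
  mem_box.mpr fun i => ⟨(mem_box.mp hv i).1, (mem_box.mp hv i).2.trans hle⟩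

/-- **A merged absolute bound on a window inside the design box IS the 3ᴬ-box at θ** (n°79's ★ direction we need, re-proved over tree imports).
[cite: Balaban1987RG1, §1 p.264 («uniformly bounded») and (1.22) p.264] -/
theorem absBox_of_mergedAbsBound {γ₀ β' : ℝ} (hle : γ₀ ≤ θ.γ)
    (h : letI := θ.instVβ₁; letI := θ.instVβ₂; letI := θ.instιβ
      ∀ k (v : Fin (k + 1) → ℝ), v ∈ Box γ₀ k →
        |betaMerged F (mergedTermFamilyMatT F N (TcanOfRecord F N) (chiFixed29 F N θ.ν θ.ε₂₉) θ.εbg) θ.ρ8 θ.bV k v| ≤ β') :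
    BetaLowerH (-β') γ₀ (betaOfRecord₁₃ F N θ) ∧ BetaUpperH β' γ₀ (betaOfRecord₁₃ F N θ) := by
  letI := θ.instVβ₁; letI := θ.instVβ₂; letI := θ.instιβ
  constructor
  · intro k v hv
    rw [betaOfRecord₁₃_eq_merged_of_mem F N θ (box_mono hle hv)]
    exact (abs_le.mp (h k v hv)).1
  · intro k v hv
    rw [betaOfRecord₁₃_eq_merged_of_mem F N θ (box_mono hle hv)]
    exact (abs_le.mp (h k v hv)).2

/-- **★ EXPONENTIAL ROAD AT θ: finite-volume K-uniform decay + K4 ⟹ the 3ᴬ-box at θ** with `β′ = β′₅₁₀(C, δ₁)` (through (UD) at θ = n°79's `UniformDecay510At` body,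
`B12Sec2to5.secondMoment_abs_le_of_decay510`). [cite: Balaban1987RG1, (5.10) p.293, (5.42) p.297, (1.21)–(1.22) p.264] -/
theorem absBox_of_finVolDecay_polLimit {γ₀ C δ₁ : ℝ} (hle : γ₀ ≤ θ.γ) (hδ : 0 < δ₁)
    (hD : FinVolDecayOnBoxAt F N θ γ₀ C δ₁) (hL : PolLimitExistsOnBoxAt F N θ γ₀) :
    BetaLowerH (-betaPrime510 4 C δ₁) γ₀ (betaOfRecord₁₃ F N θ) ∧ BetaUpperH (betaPrime510 4 C δ₁) γ₀ (betaOfRecord₁₃ F N θ) := by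
  letI := θ.instVβ₁; letI := θ.instVβ₂; letI := θ.instιβ
  refine absBox_of_mergedAbsBound F N θ hle fun k v hv => ?_
  have hdec := decay510_polLimit_of_finVol F (k + 1)
    (fun K => mergedTermFamilyMatT F N (TcanOfRecord F N) (chiFixed29 F N θ.ν θ.ε₂₉) θ.εbg k v K) θ.ρ8 θ.bV 0 1 (hL k v hv) (hD k v hv)
  exact (secondMoment_abs_le_of_decay510 hδ hdec).2

/-- **★ MOMENT ROAD AT θ: finite-volume K-uniform absolute weighted moments + K4 ⟹ the 3ᴬ-box at θ** with `β′ = M` (through (MB) at θ = n°79's `MergedAbsBddAt` body; Fatou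
for sums, with summability). [cite: Balaban1987RG1, (1.21)–(1.22) p.264] -/
theorem absBox_of_finVolAbsMoment_polLimit {γ₀ M : ℝ} (hle : γ₀ ≤ θ.γ)
    (hM : FinVolAbsMomentOnBoxAt F N θ γ₀ M) (hL : PolLimitExistsOnBoxAt F N θ γ₀) :
    BetaLowerH (-M) γ₀ (betaOfRecord₁₃ F N θ) ∧ BetaUpperH M γ₀ (betaOfRecord₁₃ F N θ) := by
  letI := θ.instVβ₁; letI := θ.instVβ₂; letI := θ.instιβ
  refine absBox_of_mergedAbsBound F N θ hle fun k v hv => ?_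
  exact (abs_secondMoment_polLimit_le_of_finVol F (k + 1)
    (fun K => mergedTermFamilyMatT F N (TcanOfRecord F N) (chiFixed29 F N θ.ν θ.ε₂₉) θ.εbg k v K) θ.ρ8 θ.bV 0 1 (hL k v hv) (hM k v hv)).2

/-- Under K3's content the chart is `C²` at `0`, so (1.20) is a genuine, symmetric Hessian there (`B12PolarizationTensor120.polTensor_swap`) — the non-junk road.
[cite: Balaban1987RG1, (1.20) p.264] -/
theorem polTensor_symmetric_of_chartC2 {γ₀ : ℝ} (hC : ChartC2OnBoxAt F N θ γ₀) {k : ℕ} {v : Fin (k + 1) → ℝ} (hv : v ∈ Box γ₀ k) (K : ℕ) :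
    letI := θ.instVβ₁; letI := θ.instVβ₂; letI := θ.instιβ
    ∀ μ x a ν y b,
      B12PolarizationTensor120.polTensor ℝ
          (B12PolarizationTensor120.expChart (mergedTermFamilyMatT F N (TcanOfRecord F N) (chiFixed29 F N θ.ν θ.ε₂₉) θ.εbg k v K) θ.ρ8) μ x a ν y b =
        B12PolarizationTensor120.polTensor ℝ
          (B12PolarizationTensor120.expChart (mergedTermFamilyMatT F N (TcanOfRecord F N) (chiFixed29 F N θ.ν θ.ε₂₉) θ.εbg k v K) θ.ρ8) ν y b μ x a := by
  letI := θ.instVβ₁; letI := θ.instVβ₂; letI := θ.instιβ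
  intro μ x a ν y b
  exact B12PolarizationTensor120.polTensor_swap ℝ (hC k v hv K) μ x a ν y b

end AtTheta

/-! ## §4b (edition 2 §4, kept verbatim). AT V19's SOCKET 3ᴬ′ (the (j, c)-generic collared witness): the two finite-volume roads + K4 ⟹ `AbsBetaBoxAtThm1WitnessCCMGenAt F` BY NAME (PROVED) -/

section AtWitness

/-- **THE GUARD ∕ STEP-FACT PREFIX OF V19's 3ᴬ′** (verbatim binders of `K0V19Defs.AbsBetaBoxAtThm1WitnessCCMGenAt`; = n°84's generic prefix), the node-O clause `P` a parameter:
SOME thresholds `ε₀, ε₂₉ > 0` with `P j ε₀ ε₂₉ B₃ B₃′ a₀ a₁`. [cite: Balaban1985Variational, Thm 1 p.279; Balaban1988Convergent, Thm 1 p.262 (bookkeeping)] -/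
def AtWitnessGen (F : T4Family) (P : ℕ → ℝ → ℝ → ℝ → ℝ → ℝ → ℝ → Prop) : Prop :=
  ∀ (j c : ℕ) (B₃ B₃' a₀ a₁ : ℝ), c ≤ F.L ^ j → 2 * (F.L : ℝ) ^ 2 ≤ B₃ → 0 < B₃' → 0 < a₀ → 0 < a₁ →
    VariationalThm1RegSepCoP7M F 2 B₃ a₀ a₁ →
    Gauge9RegSepTopStepR F 2 (fun ν K Ω => suppDomOfRecord F ν K Ω) (F.L ^ j) c B₃ B₃' a₀ a₁ →
    ∃ ε₀ ε₂₉ : ℝ, 0 < ε₀ ∧ 0 < ε₂₉ ∧ P j ε₀ ε₂₉ B₃ B₃' a₀ a₁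

/-- **★★ EXPONENTIAL ROAD TO 3ᴬ′**: at the collared witness `θ₁₃ᶜᶜᴹ(j; ε₀, ε₂₉; B₃, B₃′, a₀, a₁)` (design box `γ = ½`), SOME window `γ₀ ∈ ]0, ½]` carrying K-uniform finite-volume
(5.10)-decay on the window AND K4 ⟹ V19's socket `AbsBetaBoxAtThm1WitnessCCMGenAt F` (β′ := β′₅₁₀(C, δ₁)).  CONDITIONAL on the two clauses (not proved here); K0⁷ OPEN.
[cite: Balaban1987RG1, Thm 1 p.259, §1 p.264, (5.10) p.293; Balaban1988Convergent, Thm 1 p.262] -/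
theorem absBetaBoxGen_of_finVolDecay_polLimit (F : T4Family)
    (h : AtWitnessGen F fun j ε₀ ε₂₉ B₃ B₃' a₀ a₁ =>
      ∃ γ₀ C δ₁ : ℝ, 0 < γ₀ ∧ γ₀ ≤ 1 / 2 ∧ 0 < δ₁ ∧
        FinVolDecayOnBoxAt F 2 (theta13OfThm1CCM F 2 j ε₀ ε₂₉ B₃ B₃' a₀ a₁) γ₀ C δ₁ ∧
        PolLimitExistsOnBoxAt F 2 (theta13OfThm1CCM F 2 j ε₀ ε₂₉ B₃ B₃' a₀ a₁) γ₀) :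
    AbsBetaBoxAtThm1WitnessCCMGenAt F := by
  intro j c B₃ B₃' a₀ a₁ hc hB hB' ha₀ ha₁ h15 h9
  obtain ⟨ε₀, ε₂₉, hε₀, hε₂₉, γ₀, C, δ₁, hγ₀, hle, hδ, hD, hL⟩ := h j c B₃ B₃' a₀ a₁ hc hB hB' ha₀ ha₁ h15 h9
  have hle' : γ₀ ≤ (theta13OfThm1CCM F 2 j ε₀ ε₂₉ B₃ B₃' a₀ a₁).γ := by
    rw [theta13OfThm1CCM_γ]; exact hle
  exact ⟨γ₀, ε₀, ε₂₉, betaPrime510 4 C δ₁, hγ₀, hε₀, hε₂₉, absBox_of_finVolDecay_polLimit F 2 _ hle' hδ hD hL⟩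

/-- **★★ MOMENT ROAD TO 3ᴬ′**: the same with the K-uniform absolute weighted-moment bound `M` in place of (5.10)-decay (β′ := M) — strictly less than the (5.10) SHAPE
(which K3⁷ `stub_rates13` wants; this road does NOT feed K3⁷ — scope as in ed.1).  CONDITIONAL; K0⁷ OPEN. [cite: Balaban1987RG1, Thm 1 p.259, §1 p.264, (1.22) p.264] -/
theorem absBetaBoxGen_of_finVolAbsMoment_polLimit (F : T4Family)
    (h : AtWitnessGen F fun j ε₀ ε₂₉ B₃ B₃' a₀ a₁ =>
      ∃ γ₀ M : ℝ, 0 < γ₀ ∧ γ₀ ≤ 1 / 2 ∧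
        FinVolAbsMomentOnBoxAt F 2 (theta13OfThm1CCM F 2 j ε₀ ε₂₉ B₃ B₃' a₀ a₁) γ₀ M ∧
        PolLimitExistsOnBoxAt F 2 (theta13OfThm1CCM F 2 j ε₀ ε₂₉ B₃ B₃' a₀ a₁) γ₀) :
    AbsBetaBoxAtThm1WitnessCCMGenAt F := by
  intro j c B₃ B₃' a₀ a₁ hc hB hB' ha₀ ha₁ h15 h9
  obtain ⟨ε₀, ε₂₉, hε₀, hε₂₉, γ₀, M, hγ₀, hle, hM, hL⟩ := h j c B₃ B₃' a₀ a₁ hc hB hB' ha₀ ha₁ h15 h9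
  have hle' : γ₀ ≤ (theta13OfThm1CCM F 2 j ε₀ ε₂₉ B₃ B₃' a₀ a₁).γ := by
    rw [theta13OfThm1CCM_γ]; exact hle
  exact ⟨γ₀, ε₀, ε₂₉, M, hγ₀, hε₀, hε₂₉, absBox_of_finVolAbsMoment_polLimit F 2 _ hle' hM hL⟩

end AtWitness

/-! ## §5. C5 — SELECTION-INDEPENDENCE OF THE MERGED TERM (answers CRIT-2 ROUND-2 C5 by a proof over the record's own hypotheses)

`Uk F N K (k+1) ε W` is `Classical.choose` of a minimiser ([I] p.260 «a configuration in the minimal orbit»).  CRIT-2: differentiating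
`W ↦ mergedTermT … k W` needs (i) selection-independence, (ii) a smooth branch, (iii) invariance making the choice immaterial.  (i)+(iii) are ONE fact and it
is PROVED here from two hypotheses the record's telescoping (0.23) already carries by name: uniqueness of the minimal orbit `UniqueUkOrbit` ([15] Thm 1) and
residual-gauge invariance `HInvT` of `A_k ∘ Ū^k` ([I] (0.21), (0.24)).  What remains of K3 is (ii) + differentiation under the compact Haar fibre integral. -/

section SelIndep

variable {F : T4Family} {N : ℕ} [NeZero N]

/-- **The second summand of the merged term does not see the selector**: any two backgrounds of `W` give the same `A_k(Ū^k ·)`.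
[cite: Balaban1987RG1, (0.24) p.257 and (1.1) p.260; Balaban1985Variational, Thm 1 p.279] -/
theorem effAction_iter_eq_of_isBackground (T : Transport F N) (χ : (K : ℕ) → (ℕ → ℝ) → (k : ℕ) → Density (F.P K) k (SU N)) {ε : ℝ} {K : ℕ}
    {g : ℕ → ℝ} {k : ℕ} {W : GaugeField (F.P K) (k + 1) (SU N)} (hU : UniqueUkOrbit F N K (k + 1) ε W) (hI : HInvT F N T χ K g (k + 1))
    {U₀ U₁ : GaugeField (F.P K) 0 (SU N)} (h₀ : IsBackground (avOfRecord F N K) (bgReg F N K (k + 1) ε) (k + 1) W U₀)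
    (h₁ : IsBackground (avOfRecord F N K) (bgReg F N K (k + 1) ε) (k + 1) W U₁) :
    effActionHT F N T χ K g k (Averaging.iter (avOfRecord F N K) k U₀) =
      effActionHT F N T χ K g k (Averaging.iter (avOfRecord F N K) k U₁) := by
  obtain ⟨u, hu, hEq⟩ := hU U₀ U₁ h₀ h₁
  rw [hEq, hI k (Nat.lt_succ_self k) u hu U₀]

/-- **SELECTION-INDEPENDENCE OF THE MERGED TERM (C5)**: `𝓝_{k+1}(g; W) = A_{k+1}(g; W) − A_k(g; Ū^k U₀)` for EVERY solution `U₀` of (0.21) over `W`.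
So on the window (where `UkExists` holds) the `Classical.choose` in `Uk` may be replaced by any branch of minimisers — in particular by a smooth one when
one exists ([15] §G) — without changing the merged term. [cite: Balaban1987RG1, (1.6) p.261, (0.24) p.257; Balaban1985Variational, Thm 1 p.279] -/
theorem mergedTermT_eq_of_isBackground (T : Transport F N) (χ : (K : ℕ) → (ℕ → ℝ) → (k : ℕ) → Density (F.P K) k (SU N)) {ε : ℝ} {K : ℕ}
    {g : ℕ → ℝ} {k : ℕ} {W : GaugeField (F.P K) (k + 1) (SU N)} (hU : UniqueUkOrbit F N K (k + 1) ε W) (hI : HInvT F N T χ K g (k + 1))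
    {U₀ : GaugeField (F.P K) 0 (SU N)} (h₀ : IsBackground (avOfRecord F N K) (bgReg F N K (k + 1) ε) (k + 1) W U₀) :
    mergedTermT F N T χ ε K g k W =
      effActionHT F N T χ K g (k + 1) W - effActionHT F N T χ K g k (Averaging.iter (avOfRecord F N K) k U₀) := by
  unfold mergedTermT
  rw [effAction_iter_eq_of_isBackground T χ hU hI (isBackground_Uk ⟨U₀, h₀⟩) h₀]

/-- **BRANCH FORM** (what K3 differentiates): for any map `sel` that picks a background of every field of a set `D` (a «branch of minimisers on `D`»), the
merged term restricted to `D` is `W ↦ A_{k+1}(W) − A_k(Ū^k (sel W))` — so `C²`-ness of the chart of the merged term on `D` reduces to that of `A_{k+1}` and of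
`A_k ∘ Ū^k ∘ sel`, i.e. to a SMOOTH BRANCH `sel` ([15] §G) and differentiation under the fibre integral; the selector of record has disappeared.
[cite: Balaban1985Variational, §G pp.305–309; Balaban1987RG1, (1.6) p.261] -/
theorem mergedTermT_eq_on_branch (T : Transport F N) (χ : (K : ℕ) → (ℕ → ℝ) → (k : ℕ) → Density (F.P K) k (SU N)) {ε : ℝ} {K : ℕ}
    {g : ℕ → ℝ} {k : ℕ} {D : Set (GaugeField (F.P K) (k + 1) (SU N))}
    (hU : ∀ W ∈ D, UniqueUkOrbit F N K (k + 1) ε W) (hI : HInvT F N T χ K g (k + 1))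
    (sel : GaugeField (F.P K) (k + 1) (SU N) → GaugeField (F.P K) 0 (SU N))
    (hsel : ∀ W ∈ D, IsBackground (avOfRecord F N K) (bgReg F N K (k + 1) ε) (k + 1) W (sel W)) :
    Set.EqOn (mergedTermT F N T χ ε K g k)
      (fun W => effActionHT F N T χ K g (k + 1) W - effActionHT F N T χ K g k (Averaging.iter (avOfRecord F N K) k (sel W))) D :=
  fun W hW => mergedTermT_eq_of_isBackground T χ (hU W hW) hI (hsel W hW)

end SelIndep

/-! ## §6 (EDITION 4, g11). ERRATUM E-g11 — THE FINITE-VOLUME CURRENCY RE-TYPED, BY NAME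
§6.1 acknowledges k0-s3-w2 g2's kernel-checked negative control ON §4's OWN PREDICATES (p612426 `K0Stub3FinVolPeriodicity`): `FinVolDecayOnBoxAt` ∕ `FinVolAbsMomentOnBoxAt` ⟹ `β₁₃ ≡ 0`
on the window.  §6.2 types the honest finite-volume deliverable `EvWindowedDecayOnBoxAt` (node00-def-W1's EVENTUAL windowed-decay shape with ONE constant over the window and the
levels — verbatim the hypothesis `hK` of k0-s3-w1's p608074 `kernelDecayWindowUniform_of_windowedUniform_of_polLimitsExist`) and composes it with K4 = `PolLimitsExistOfRecord₁₃`
into the window-uniform (5.10)-decay of W1-19's LIMITING kernels.  §6.3 re-types the card's assembly target at V19's socket, `XPrimeAt F`, and reaches 3ᴬ′ and the crux decl K0⁷ BY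
NAME.  §6.4 (edition 4.1) displays the K-UNIFORM torus-reading deliverable `FundDomDecayOnBoxAt` and cites k0-s3-w2's FILE 2 p613354 `K0Stub3FinVolFace` BY NAME (box road; ⟹ §6.2's
eventual currency; `PolLimitExistsOnBoxAt` ≡ W1's `PolLimitsExistBox`, `Iff.rfl`).  Everything here is by-name bookkeeping over landed theorems; NOTHING of Bałaban is asserted; the displayed
hypotheses are NOT inhabited here; K0⁷ OPEN. -/

section Retype

open Literature.MathematicalPhysics.QuantumFieldTheory.Balaban1983to89.T4OutputRate (Window)
open Literature.MathematicalPhysics.QuantumFieldTheory.Balaban1983to89.B12Sec2to5 (l1)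
open Literature.MathematicalPhysics.QuantumFieldTheory.Balaban1983to89.Node00.U3OfKernels (histPrefix kernelA)
open Literature.MathematicalPhysics.QuantumFieldTheory.Balaban1983to89.Node00.U3KernelLetters (PolLimitsExistOfRecord₁₃)
open Summit.QuantumFields.YangMills.Theorems.K0V19Defs (Prop8StepCoPAt)
open Summit.QuantumFields.YangMills.Theorems.K0V19Stub2Prime (record13SepCoPHInhabited_of_stub1_stub3A'_byName)
open Summit.QuantumFields.YangMills.Theorems.K0Stub3RunwiseSuppliers (kernelDecayWindowUniform_of_windowedUniform_of_polLimitsExist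
  absBetaBoxGenAt_of_kernelDecayWindowUniformAt)
open Summit.QuantumFields.YangMills.Theorems.K0Stub3FinVolPeriodicity (betaOfRecord₁₃_eq_zero_of_finVolDecayOnBox betaOfRecord₁₃_eq_zero_of_finVolAbsMomentOnBox)

section AtThetaRetype

variable (F : T4Family) (N : ℕ) [NeZero N]

/-- **§6.1 NEGATIVE CONTROL ON MY OWN PREDICATE, decay form (k0-s3-w2 g2, by name)**: §4's `FinVolDecayOnBoxAt θ γ₀ C δ₁` (`γ₀ ≤ θ.γ`, `δ₁ > 0`) forces `β₁₃(θ) ≡ 0` on `]0, γ₀]`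
— the windowed finite-torus kernels are ℤ⁴-periodic, a periodic function exponentially bounded on all of ℤ⁴ is `0`, hence so are the (1.21) limits and (1.22).  So §4's exponential road
is walked only where `β ≡ 0`: STRUCK from the line. [cite: Balaban1987RG1, (1.20)–(1.22) p.264, (5.10) p.293 (a TORUS-distance bound)] -/
theorem betaOfRecord₁₃_eq_zero_of_finVolDecayOnBoxAt (θ : Stage13Params F N) {γ₀ C δ₁ : ℝ} (hle : γ₀ ≤ θ.γ) (hδ : 0 < δ₁)
    (hD : FinVolDecayOnBoxAt F N θ γ₀ C δ₁) {k : ℕ} {v : Fin (k + 1) → ℝ} (hv : v ∈ Box γ₀ k) : betaOfRecord₁₃ F N θ k v = 0 :=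
  betaOfRecord₁₃_eq_zero_of_finVolDecayOnBox F N θ hle hδ hD hv

/-- **§6.1 NEGATIVE CONTROL ON MY OWN PREDICATE, moment form (k0-s3-w2 g2, by name)**: §4's `FinVolAbsMomentOnBoxAt θ γ₀ M` (K-uniform bounds on ALL finite partial sums over ℤ⁴)
likewise forces `β₁₃(θ) ≡ 0` on `]0, γ₀]`; §4's moment road is STRUCK from the line. [cite: Balaban1987RG1, (1.20)–(1.22) p.264] -/
theorem betaOfRecord₁₃_eq_zero_of_finVolAbsMomentOnBoxAt (θ : Stage13Params F N) {γ₀ M : ℝ} (hle : γ₀ ≤ θ.γ)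
    (hM : FinVolAbsMomentOnBoxAt F N θ γ₀ M) {k : ℕ} {v : Fin (k + 1) → ℝ} (hv : v ∈ Box γ₀ k) : betaOfRecord₁₃ F N θ k v = 0 :=
  betaOfRecord₁₃_eq_zero_of_finVolAbsMomentOnBox F N θ hle hM hv

/-- **§6.2 THE RE-TYPED FINITE-VOLUME DELIVERABLE OF K1–K3 AT θ** (replaces §4's `FinVolDecayOnBoxAt` ∕ `FinVolAbsMomentOnBoxAt` in the line): ONE-constant (5.10)-type bounds
`|Π^{(K)}_{k+1,01}(g₀,…,g_k; z)| ≤ C e^{−δ₁|z|₁}` on the windowed finite-torus kernels of the merged term of record, holding EVENTUALLY in the volume index `K` at each `z ∈ ℤ⁴`, for every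
history `g ∈ ]0, γ₀]^ℕ` and every level `k` — node00-def-W1's EVENTUAL windowed-decay shape with the constant moved outside; verbatim the hypothesis `hK` of k0-s3-w1's
`K0Stub3RunwiseSuppliers.kernelDecayWindowUniform_of_windowedUniform_of_polLimitsExist`.  NOT vacuous: print's (5.10) in TORUS distance with K-, k-, history-free constants inhabits it (for
fixed `z` the fundamental domain of `T^{(k+1)}_K` eventually contains `z`, where torus distance = `|z|₁`), and it forces no history-blindness (only the `∀ K` ℤ⁴-distance letters do,
p612426 §2b).  A HYPOTHESIS SHAPE; never asserted. [cite: Balaban1987RG1, (5.10) p.293, (1.21) p.264] -/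
def EvWindowedDecayOnBoxAt (θ : Stage13Params F N) (γ₀ C δ₁ : ℝ) : Prop :=
  letI := θ.instVβ₁; letI := θ.instVβ₂; letI := θ.instιβ
  ∀ g ∈ Window γ₀, ∀ (k : ℕ) (z : Fin 4 → ℤ), ∀ᶠ K in atTop,
    |polWindow F K (k + 1) (mergedTermFamilyMatT F N (TβOfRecord₁₃ F N) (chiβOfRecord₁₃ F N θ) θ.εbg k (histPrefix g k) K) θ.ρ8 θ.bV 0 1 z| ≤ C * Real.exp (-δ₁ * l1 z)

/-- **§6.2 ★ THE RE-TYPED ROAD AT θ, first leg (k0-s3-w1 p608074 §3, by name)**: K4 = W1's (1.21) letter of record `PolLimitsExistOfRecord₁₃ F N θ` + `EvWindowedDecayOnBoxAt θ γ₀ C δ₁`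
(`γ₀ ≤ θ.γ`) ⟹ ONE-constant (5.10)-decay of W1-19's LIMITING kernels `kernelA` over the window `]0, γ₀]^ℕ`, all levels (`le_of_tendsto` on `|·|`, inside the cited junction).  Estimate-free.
[cite: Balaban1987RG1, (5.10) p.293, (1.21) p.264] -/
theorem kernelDecayWindowUniform_of_evWindowedDecayOnBoxAt (θ : Stage13Params F N) {γ₀ C δ₁ : ℝ} (hγ : γ₀ ≤ θ.γ)
    (hlim : PolLimitsExistOfRecord₁₃ F N θ) (hK : EvWindowedDecayOnBoxAt F N θ γ₀ C δ₁) :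
    letI := θ.instVβ₁; letI := θ.instVβ₂; letI := θ.instιβ
    ∀ g ∈ Window γ₀, ∀ k : ℕ, Decay510 (kernelA F (mergedTermFamilyMatT F N (TβOfRecord₁₃ F N) (chiβOfRecord₁₃ F N θ) θ.εbg) θ.ρ8 θ.bV g k 0 1) C δ₁ :=
  kernelDecayWindowUniform_of_windowedUniform_of_polLimitsExist F N θ hγ hlim hK

end AtThetaRetype

section AtWitnessRetype

/-- **§6.3 X′ — THE CARD's ASSEMBLY TARGET RE-TYPED AT V19's SOCKET** (replaces ed.3's `X` = «`FinVolAbsMomentOnBoxAt … M ∧ PolLimitExistsOnBoxAt …` at the collared witness»): for every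
cube letter `(j, c)` and guarded tuple carrying [15] Thm 1 (8) and the (9)-token, SOME thresholds `ε₀, ε₂₉ > 0`, window `0 < γ₀ ≤ ½` and constants `C`, `δ₁ > 0` such that at A1's witness
`θ₁₃ᶜᶜᴹ(j; ε₀, ε₂₉; B₃, B₃′, a₀, a₁)` BOTH K4 (`PolLimitsExistOfRecord₁₃`, [I] (1.21)) AND the eventual one-constant windowed (5.10)-decay (`EvWindowedDecayOnBoxAt`, what K1–K3 are to
deliver in TORUS distance) hold.  A HYPOTHESIS SHAPE; NOT inhabited here. [cite: Balaban1987RG1, Thm 1 p.259, §1 p.264, (1.21) p.264, (5.10) p.293; Balaban1985Variational, Thm 1 p.279;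
Balaban1988Convergent, Thm 1 p.262] -/
def XPrimeAt (F : T4Family) : Prop :=
  ∀ (j c : ℕ) (B₃ B₃' a₀ a₁ : ℝ), c ≤ F.L ^ j → 2 * (F.L : ℝ) ^ 2 ≤ B₃ → 0 < B₃' → 0 < a₀ → 0 < a₁ →
    VariationalThm1RegSepCoP7M F 2 B₃ a₀ a₁ →
    Gauge9RegSepTopStepR F 2 (fun ν K Ω => suppDomOfRecord F ν K Ω) (F.L ^ j) c B₃ B₃' a₀ a₁ →
    ∃ ε₀ ε₂₉ γ₀ C δ₁ : ℝ, 0 < ε₀ ∧ 0 < ε₂₉ ∧ 0 < γ₀ ∧ γ₀ ≤ 1 / 2 ∧ 0 < δ₁ ∧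
      PolLimitsExistOfRecord₁₃ F 2 (theta13OfThm1CCM F 2 j ε₀ ε₂₉ B₃ B₃' a₀ a₁) ∧
      EvWindowedDecayOnBoxAt F 2 (theta13OfThm1CCM F 2 j ε₀ ε₂₉ B₃ B₃' a₀ a₁) γ₀ C δ₁

/-- **§6.3 ★★ X′ ⟹ V19's SOCKET 3ᴬ′ BY NAME** (`K0V19Defs.AbsBetaBoxAtThm1WitnessCCMGenAt F`, `β′ := β′₅₁₀(C, δ₁)` inside the cited junction): §6.2 at the witness (`.γ = ½`,
`theta13OfThm1CCM_γ`) then k0-s3-w1's `absBetaBoxGenAt_of_kernelDecayWindowUniformAt`.  CONDITIONAL on `XPrimeAt F` (NOT proved); stub 3ᴬ′ NOT proved; K0⁷ OPEN.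
[cite: Balaban1987RG1, (5.10) p.293, (5.42) p.297, (1.21)–(1.22) p.264, §1 p.264 («uniformly bounded»)] -/
theorem absBetaBoxGenAt_of_xPrimeAt (F : T4Family) (h : XPrimeAt F) : AbsBetaBoxAtThm1WitnessCCMGenAt F := by
  refine absBetaBoxGenAt_of_kernelDecayWindowUniformAt F fun j c B₃ B₃' a₀ a₁ hc hB hB' ha₀ ha₁ h15 h9 => ?_
  obtain ⟨ε₀, ε₂₉, γ₀, C, δ₁, hε₀, hε₂₉, hγ₀, hle, hδ, hlim, hK⟩ := h j c B₃ B₃' a₀ a₁ hc hB hB' ha₀ ha₁ h15 h9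
  have hle' : γ₀ ≤ (theta13OfThm1CCM F 2 j ε₀ ε₂₉ B₃ B₃' a₀ a₁).γ := by
    rw [theta13OfThm1CCM_γ]; exact hle
  exact ⟨ε₀, ε₂₉, γ₀, C, δ₁, hε₀, hε₂₉, hγ₀, hle, hδ,
    kernelDecayWindowUniform_of_evWindowedDecayOnBoxAt F 2 _ hle' hlim hK⟩

/-- **§6.3 ★★★ THE CRUX DECL K0⁷ BY NAME FROM V19 STUB 1's TEXT AND X′ AT EVERY FAMILY** (stub 2′ p595104 enters inside `K0V19Stub2Prime.record13SepCoPHInhabited_of_stub1_stub3A'_byName`;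
3ᴬ′ via `absBetaBoxGenAt_of_xPrimeAt`) — the card's «Assembly sketch» in its re-typed currency, kernel-checked.  CONDITIONAL on `h1` (stub 1's registered text, OPEN) and `hX` (the
card's K1–K4 deliverable, OPEN); a helper shape, not a closer; K0⁷ OPEN; the Clay problem untouched. [cite: Balaban1985Variational, Thm 1 (8)–(9) p.279, Prop. 8 p.304;
Balaban1988Convergent, Thm 1 p.262; Balaban1987RG1, Thm 1 p.259, §1 p.264, (5.10) p.293] -/
theorem record13SepCoPHInhabited_of_stub1_of_xPrimeAt (h1 : ∀ F : T4Family, Prop8StepCoPAt F) (hX : ∀ F : T4Family, XPrimeAt F) :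
    Summit.QuantumFields.YangMills.Theses.BalabanUVNodes.Record13SepCoPHInhabited :=
  record13SepCoPHInhabited_of_stub1_stub3A'_byName h1 fun F => absBetaBoxGenAt_of_xPrimeAt F (hX F)

end AtWitnessRetype

section FundamentalDomainTwin

open Literature.MathematicalPhysics.QuantumFieldTheory.Balaban1983to89.Node00.U3KernelLetters (PolLimitsExistBox)
open Summit.QuantumFields.YangMills.Theorems.K0Stub3FinVolFace (absBox_betaOfRecord₁₃_of_fundamentalDomainDecayOnBox uniformEventualDecayOnBox_of_fundamentalDomain)

variable (F : T4Family) (N : ℕ) [NeZero N]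

/-- **§6.4 THE K-UNIFORM FINITE-VOLUME DELIVERABLE AT θ IN PRINT's TORUS READING** (k0-s3-w2 FILE 2 p613354's face (FD), displayed as a predicate): for EVERY volume index `K`, level `k`
and box history `v ∈ ]0, γ₀]^{k+1}`, ONE pair `(C, δ₁)` bounds the windowed finite-torus kernel `|Π_K(v; z)| ≤ C e^{−δ₁|z|₁}` on the centred FUNDAMENTAL WINDOW `2|z_i| < 2L^{m+K−k−1}` of
`T^{(k+1)}_K` (there torus distance = `|z|₁`).  This is what K1–K3 are to deliver, K-uniformly — the honest replacement of §4's `FinVolDecayOnBoxAt` (same letters, the domain of `z`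
restricted to where the unwrapped kernel is not forced periodic-hence-zero).  A HYPOTHESIS SHAPE; never asserted. [cite: Balaban1987RG1, (5.10) p.293 (torus distance), (1.21) p.264] -/
def FundDomDecayOnBoxAt (θ : Stage13Params F N) (γ₀ C δ₁ : ℝ) : Prop :=
  letI := θ.instVβ₁; letI := θ.instVβ₂; letI := θ.instιβ
  ∀ k (v : Fin (k + 1) → ℝ), v ∈ Box γ₀ k → ∀ K (z : Fin 4 → ℤ), (∀ i, 2 * |z i| < ((F.P K).sitesPerDir (k + 1) : ℤ)) →
    |polWindow F K (k + 1) (mergedTermFamilyMatT F N (TβOfRecord₁₃ F N) (chiβOfRecord₁₃ F N θ) θ.εbg k v K) θ.ρ8 θ.bV 0 1 z| ≤ C * Real.exp (-δ₁ * l1 z)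

/-- **§6.4 DEDUP CERTIFICATE: my K4 stub `PolLimitExistsOnBoxAt θ γ₀` (edition 2 §3, kept) IS node00-def-W1's box letter `U3KernelLetters.PolLimitsExistBox` at the merged term of record**
(`Iff.rfl`: `TβOfRecord₁₃` ∕ `chiβOfRecord₁₃` are `abbrev`s of `TcanOfRecord` ∕ `chiFixed29 θ.ν θ.ε₂₉`). [cite: Balaban1987RG1, (1.21) p.264 (bookkeeping)] -/
theorem polLimitExistsOnBoxAt_iff_box (θ : Stage13Params F N) (γ₀ : ℝ) :
    PolLimitExistsOnBoxAt F N θ γ₀ ↔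
      (letI := θ.instVβ₁; letI := θ.instVβ₂; letI := θ.instιβ
       PolLimitsExistBox F (mergedTermFamilyMatT F N (TβOfRecord₁₃ F N) (chiβOfRecord₁₃ F N θ) θ.εbg) θ.ρ8 θ.bV γ₀) :=
  Iff.rfl

/-- **§6.4 ★ THE K-UNIFORM TWIN ROAD AT θ (k0-s3-w2 p613354, by name)**: `FundDomDecayOnBoxAt θ γ₀ C δ₁` + K4 (`PolLimitExistsOnBoxAt θ γ₀`, = W1's box letter) ⟹ the sign-free box
`−β′₅₁₀ ≤ β₁₃(θ) ≤ β′₅₁₀` on `]0, γ₀]` (`γ₀ ≤ θ.γ`, `δ₁ > 0`) — the drop-in for §4's struck `absBox_of_finVolDecay_polLimit`.  CONDITIONAL; nothing asserted.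
[cite: Balaban1987RG1, (1.20)–(1.22) p.264, (5.10) p.293, (5.42) p.297] -/
theorem absBox_of_fundDomDecayOnBoxAt (θ : Stage13Params F N) {γ₀ C δ₁ : ℝ} (hle : γ₀ ≤ θ.γ) (hδ : 0 < δ₁)
    (hL : PolLimitExistsOnBoxAt F N θ γ₀) (hD : FundDomDecayOnBoxAt F N θ γ₀ C δ₁) :
    BetaLowerH (-betaPrime510 4 C δ₁) γ₀ (betaOfRecord₁₃ F N θ) ∧ BetaUpperH (betaPrime510 4 C δ₁) γ₀ (betaOfRecord₁₃ F N θ) :=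
  absBox_betaOfRecord₁₃_of_fundamentalDomainDecayOnBox F N θ hle hδ ((polLimitExistsOnBoxAt_iff_box F N θ γ₀).mp hL) hD

/-- **§6.4 K-UNIFORM (torus reading) ⟹ §6.2's EVENTUAL window currency**: `FundDomDecayOnBoxAt θ γ₀ C δ₁ → EvWindowedDecayOnBoxAt θ γ₀ C δ₁` (the history prefix of a window sequence
is a box point; for fixed `z` the fundamental window eventually contains `z`, `sitesPerDir_tendsto_atTop` inside p613354's `uniformEventualDecayOnBox_of_fundamentalDomain`).  So ONE deliverable,
read on the torus, feeds both §6.3's `XPrimeAt` road and §6.4's box road. [cite: Balaban1987RG1, (5.10) p.293, (1.21) p.264 (bookkeeping)] -/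
theorem evWindowedDecayOnBoxAt_of_fundDomDecayOnBoxAt (θ : Stage13Params F N) {γ₀ C δ₁ : ℝ} (hD : FundDomDecayOnBoxAt F N θ γ₀ C δ₁) :
    EvWindowedDecayOnBoxAt F N θ γ₀ C δ₁ := by
  letI := θ.instVβ₁; letI := θ.instVβ₂; letI := θ.instιβ
  intro g hg k z
  have hbox : histPrefix g k ∈ Box γ₀ k := mem_box.mpr fun i => hg i
  exact uniformEventualDecayOnBox_of_fundamentalDomain F N θ hD k (histPrefix g k) hbox z

end FundamentalDomainTwin

/-! ## §6.5 (EDITION 4.2, g14). ERRATUM-LITE E-g14 — THE WINDOW-EDITION RE-KEY OF THE ASSEMBLY TARGET, BY NAME (k0-s3-w1 g0-0 p618788 `K0Stub3SocketWindowEdition`)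
§6.3's `XPrimeAt F` asks K4 = `PolLimitsExistOfRecord₁₃ F 2 θ₁₅ᶜᶜᴹ(j)` on `Window ½` (the collared witness's design window) — (1.21) for all couplings up to `½` — while the decay
letter already carries its own radius `γ₀`.  Print's (1.7) ∕ (1.21) are claimed for «γ sufficiently small» only ([I] Thm 1 p.255, §1 p.264, (1.7) p.261; [II] (1.4) p.357), so the
K4 conjunct of `XPrimeAt` OVER-DEMANDS — harmless for §6.3 ★★ as a theorem, wrong as the text of the line's FIRST stub.  The window edition p618788 makes the repair available BY NAME:
deliver BOTH letters at A2ʷ's WINDOW WITNESS `θ₁₅ᶜᶜᴹᵂ(j; γ₀, ε₀, ε₂₉; B₃, B₃′, a₀, a₁)`, whose design window IS `γ₀`, and feed p618788's road schema with this card's own-window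
letter package.  `XDoublePrimeAt` is WEAKER than `XPrimeAt` (last theorem), reaches 3ᴬ′ and K0⁷ BY NAME, and is the deliverable a crux-plan seat should register (K4 FIRST:
`PolLimitsExistOfRecord₁₃ F 2 θ₁₅ᶜᶜᴹᵂ(j; γ₀)`; K1b–K3: `EvWindowedDecayOnBoxAt F 2 θ₁₅ᶜᶜᴹᵂ(j; γ₀) γ₀ C δ₁` in TORUS reading via §6.4).  By-name bookkeeping over landed theorems;
NOTHING of Bałaban asserted; the displayed hypotheses are NOT inhabited here; stub 3ᴬ′ NOT proved; K0⁷ OPEN. -/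

section WindowEditionRekey

open Summit.QuantumFields.YangMills.Theorems.K0Stub3RunwiseSuppliers (absBetaBox_of_kernelDecayWindowUniform)
open Summit.QuantumFields.YangMills.Theorems.K0Stub3SocketWindowEdition (abs3A'_of_genericRoadAtWindowWitness
  record13SepCoPHInhabited_of_stub1_genericRoadAtWindowWitness_byName)

/-- **§6.5 THE CARD's OWN-WINDOW LETTER PACKAGE AT θ** — the `P θ` this card offers to p618788's road schema: K4 = W1's (1.21) letter of record `PolLimitsExistOfRecord₁₃ F 2 θ`
(histories of the record's OWN window `Window θ.γ`) and the eventual one-constant windowed (5.10)-decay `EvWindowedDecayOnBoxAt θ θ.γ C δ₁` (§6.2's currency, radius `θ.γ`) for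
SOME `C` and `δ₁ > 0`.  A HYPOTHESIS SHAPE; never asserted. [cite: Balaban1987RG1, (1.21) p.264, (5.10) p.293, §1 p.264] -/
def OwnWindowDecayPackageAt (F : T4Family) (θ : Stage13Params F 2) : Prop :=
  ∃ C δ₁ : ℝ, 0 < δ₁ ∧ PolLimitsExistOfRecord₁₃ F 2 θ ∧ EvWindowedDecayOnBoxAt F 2 θ θ.γ C δ₁

/-- **§6.5 ★ THE θ-GENERIC OWN-WINDOW ROAD** (the `hroad` of p618788's schema for this package): `OwnWindowDecayPackageAt F θ` ⟹ the sign-free box `−β′ ≤ β₁₃(θ) ≤ β′` on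
`]0, θ.γ]`, `β′ = β′₅₁₀(4; C, δ₁)` — §6.2 at `γ₀ := θ.γ`, then k0-s3-w1's `absBetaBox_of_kernelDecayWindowUniform` (p608074 §3).  Estimate-free; CONDITIONAL on the package.
[cite: Balaban1987RG1, (5.10) p.293, (5.42) p.297, (1.21)–(1.22) p.264, §1 p.264 («uniformly bounded»)] -/
theorem absBox_of_ownWindowDecayPackageAt (F : T4Family) (θ : Stage13Params F 2) (h : OwnWindowDecayPackageAt F θ) :
    ∃ β' : ℝ, BetaLowerH (-β') θ.γ (betaOfRecord₁₃ F 2 θ) ∧ BetaUpperH β' θ.γ (betaOfRecord₁₃ F 2 θ) := by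
  obtain ⟨C, δ₁, hδ, hlim, hK⟩ := h
  exact ⟨betaPrime510 4 C δ₁,
    absBetaBox_of_kernelDecayWindowUniform F 2 θ hδ le_rfl (kernelDecayWindowUniform_of_evWindowedDecayOnBoxAt F 2 θ le_rfl hlim hK)⟩

/-- **§6.5 X″ — THE CARD's ASSEMBLY TARGET IN THE WINDOW EDITION** (E-g14; supersedes §6.3's `XPrimeAt` as the DELIVERABLE — `XPrimeAt` stays a correct, over-demanding sufficient
condition): for every cube letter `(j, c)` and guarded tuple carrying [15] Thm 1 (8) and the (9)-token, SOME window `0 < γ₀ ≤ ½`, thresholds `ε₀, ε₂₉ > 0` and constants `C`, `δ₁ > 0`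
such that AT THE WINDOW WITNESS `θ₁₅ᶜᶜᴹᵂ(j; γ₀, ε₀, ε₂₉; B₃, B₃′, a₀, a₁)` (design window `γ₀`) BOTH K4 (`PolLimitsExistOfRecord₁₃`, i.e. (1.21) on `Window γ₀` — NOT on `Window ½`) AND
the eventual one-constant windowed (5.10)-decay on `]0, γ₀]` hold: print's regime «γ sufficiently small» for both letters.  A HYPOTHESIS SHAPE; NOT inhabited here.
[cite: Balaban1987RG1, Thm 1 p.255, §1 p.264, (1.7) p.261, (1.21) p.264, (5.10) p.293; Balaban1989LargeFieldII, (1.4) p.357; Balaban1985Variational, Thm 1 p.279; Balaban1988Convergent, Thm 1 p.262] -/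
def XDoublePrimeAt (F : T4Family) : Prop :=
  ∀ (j c : ℕ) (B₃ B₃' a₀ a₁ : ℝ), c ≤ F.L ^ j → 2 * (F.L : ℝ) ^ 2 ≤ B₃ → 0 < B₃' → 0 < a₀ → 0 < a₁ →
    VariationalThm1RegSepCoP7M F 2 B₃ a₀ a₁ →
    Gauge9RegSepTopStepR F 2 (fun ν K Ω => suppDomOfRecord F ν K Ω) (F.L ^ j) c B₃ B₃' a₀ a₁ →
    ∃ γ₀ ε₀ ε₂₉ C δ₁ : ℝ, 0 < γ₀ ∧ γ₀ ≤ 1 / 2 ∧ 0 < ε₀ ∧ 0 < ε₂₉ ∧ 0 < δ₁ ∧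
      PolLimitsExistOfRecord₁₃ F 2 (theta13OfThm1CCMW F 2 j γ₀ ε₀ ε₂₉ B₃ B₃' a₀ a₁) ∧
      EvWindowedDecayOnBoxAt F 2 (theta13OfThm1CCMW F 2 j γ₀ ε₀ ε₂₉ B₃ B₃' a₀ a₁) γ₀ C δ₁

/-- **§6.5 X″ INHABITS p618788's `hAt` SLOT WITH THIS CARD's PACKAGE**: per admissible tuple, the own-window package at SOME window witness `θ₁₅ᶜᶜᴹᵂ(j; γ₀)`, `0 < γ₀ ≤ ½`
(`θ₁₅ᶜᶜᴹᵂ(j; γ₀).γ = γ₀`, A2ʷ `theta13OfThm1CCMW_γ`, `rfl`).  Bookkeeping. [cite: Balaban1987RG1, §1 p.264 (bookkeeping); Balaban1989LargeFieldII, (1.4) p.357] -/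
theorem ownWindowPackageAtWindowWitness_of_xDoublePrimeAt (F : T4Family) (h : XDoublePrimeAt F) :
    ∀ (j c : ℕ) (B₃ B₃' a₀ a₁ : ℝ), c ≤ F.L ^ j → 2 * (F.L : ℝ) ^ 2 ≤ B₃ → 0 < B₃' → 0 < a₀ → 0 < a₁ →
      VariationalThm1RegSepCoP7M F 2 B₃ a₀ a₁ →
      Gauge9RegSepTopStepR F 2 (fun ν K Ω => suppDomOfRecord F ν K Ω) (F.L ^ j) c B₃ B₃' a₀ a₁ →
      ∃ γ₀ ε₀ ε₂₉ : ℝ, 0 < γ₀ ∧ γ₀ ≤ 1 / 2 ∧ 0 < ε₀ ∧ 0 < ε₂₉ ∧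
        OwnWindowDecayPackageAt F (theta13OfThm1CCMW F 2 j γ₀ ε₀ ε₂₉ B₃ B₃' a₀ a₁) := by
  intro j c B₃ B₃' a₀ a₁ hc hB hB' ha₀ ha₁ h15 h9
  obtain ⟨γ₀, ε₀, ε₂₉, C, δ₁, hγ₀, hle, hε₀, hε₂₉, hδ, hlim, hK⟩ := h j c B₃ B₃' a₀ a₁ hc hB hB' ha₀ ha₁ h15 h9
  refine ⟨γ₀, ε₀, ε₂₉, hγ₀, hle, hε₀, hε₂₉, C, δ₁, hδ, hlim, ?_⟩
  rw [theta13OfThm1CCMW_γ]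
  exact hK

/-- **§6.5 ★★ X″ ⟹ V19's SOCKET 3ᴬ′ BY NAME** (`K0V19Defs.AbsBetaBoxAtThm1WitnessCCMGenAt F`) — p618788's road schema `abs3A'_of_genericRoadAtWindowWitness` with
`P := OwnWindowDecayPackageAt F`, `hroad :=` ★ above, `hAt :=` the previous lemma.  CONDITIONAL on `XDoublePrimeAt F` (NOT proved); stub 3ᴬ′ NOT proved; K0⁷ OPEN.
[cite: Balaban1987RG1, Thm 1 p.255, §1 p.264, (1.21)–(1.22) p.264, (5.10) p.293, (5.42) p.297; Balaban1989LargeFieldII, (1.4) p.357] -/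
theorem abs3A'_of_xDoublePrimeAt (F : T4Family) (h : XDoublePrimeAt F) : AbsBetaBoxAtThm1WitnessCCMGenAt F :=
  abs3A'_of_genericRoadAtWindowWitness F (OwnWindowDecayPackageAt F) (fun θ hP _ => absBox_of_ownWindowDecayPackageAt F θ hP)
    (ownWindowPackageAtWindowWitness_of_xDoublePrimeAt F h)

/-- **§6.5 ★★★ THE CRUX DECL K0⁷ BY NAME FROM V19 STUB 1's TEXT AND X″ AT EVERY FAMILY** — p618788's family-indexed schema `record13SepCoPHInhabited_of_stub1_genericRoadAtWindowWitness_byName`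
(stub 2′ p595104 inside) fed with `P F := OwnWindowDecayPackageAt F`.  This is the card's «Assembly sketch» in the window edition, kernel-checked.  CONDITIONAL on `h1` (stub 1's registered
text, OPEN) and `hX` (the card's K1–K4 deliverable, OPEN); a helper shape, not a closer; K0⁷ OPEN; the Clay problem untouched. [cite: Balaban1985Variational, Thm 1 (8)–(9) p.279, Prop. 8 p.304;
Balaban1988Convergent, Thm 1 p.262; Balaban1987RG1, Thm 1 p.255, §1 p.264, (5.10) p.293; Balaban1989LargeFieldII, (1.4) p.357] -/
theorem record13SepCoPHInhabited_of_stub1_of_xDoublePrimeAt (h1 : ∀ F : T4Family, Prop8StepCoPAt F) (hX : ∀ F : T4Family, XDoublePrimeAt F) :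
    Summit.QuantumFields.YangMills.Theses.BalabanUVNodes.Record13SepCoPHInhabited :=
  record13SepCoPHInhabited_of_stub1_genericRoadAtWindowWitness_byName h1 (fun F => OwnWindowDecayPackageAt F)
    (fun F θ hP _ => absBox_of_ownWindowDecayPackageAt F θ hP) (fun F => ownWindowPackageAtWindowWitness_of_xDoublePrimeAt F (hX F))

/-- **§6.5 THE RE-KEY WEAKENS THE DELIVERABLE: `XPrimeAt F → XDoublePrimeAt F`.**  At the same `(γ₀, ε₀, ε₂₉; C, δ₁)`: (1.21) on `Window ½` at `θ₁₅ᶜᶜᴹ(j)` restricts to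
`Window γ₀ ⊆ Window ½`, and the window witness `θ₁₅ᶜᶜᴹᵂ(j; γ₀)` carries the SAME Stage-7 numerics, (2.9) threshold, background radius, chart and basis (A2ʷ: only `.γ` differs,
`rfl`-level), hence the same merged term family and the same windowed kernels — so both letters transfer verbatim.  (The converse fails in general: X″ says nothing about histories
with couplings in `]γ₀, ½]`.)  Bookkeeping. [cite: Balaban1987RG1, (1.21) p.264, (1.6) p.261, (2.12)–(2.14) p.268 (bookkeeping); Balaban1989LargeFieldII, (1.4) p.357] -/
theorem xDoublePrimeAt_of_xPrimeAt (F : T4Family) (h : XPrimeAt F) : XDoublePrimeAt F := by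
  intro j c B₃ B₃' a₀ a₁ hc hB hB' ha₀ ha₁ h15 h9
  obtain ⟨ε₀, ε₂₉, γ₀, C, δ₁, hε₀, hε₂₉, hγ₀, hle, hδ, hlim, hK⟩ := h j c B₃ B₃' a₀ a₁ hc hB hB' ha₀ ha₁ h15 h9
  refine ⟨γ₀, ε₀, ε₂₉, C, δ₁, hγ₀, hle, hε₀, hε₂₉, hδ, ?_, ?_⟩
  · intro g hg k
    have hg' : g ∈ Window (theta13OfThm1CCM F 2 j ε₀ ε₂₉ B₃ B₃' a₀ a₁).γ := fun i =>
      ⟨(hg i).1, (hg i).2.trans (by rw [theta13OfThm1CCMW_γ, theta13OfThm1CCM_γ]; exact hle)⟩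
    exact hlim g hg' k
  · exact hK

end WindowEditionRekey


end Retype


end YMNodeOIdeate.Idea6.HessCovK0v3
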